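import Summits.QuantumFields.QCD.Theses.NestedDissectionSea
import Literature.MathematicalPhysics.QuantumFieldTheory.ConstructiveQFTWave0OddRPProofs
import Literature.MathematicalPhysics.QuantumFieldTheory.LatticeGaugePlaquetteLowerBound
import Literature.MathematicalPhysics.QuantumFieldTheory.LatticeGaugeStaticPotentialProofs
import Summits.QuantumFields.YangMills.Theorems.LatticeGapOnTrajectory.Negative.ZeroCouplingGap
import Literature.MathematicalPhysics.QuantumFieldTheory.QuasiLocalGaugePerturbationWilson
import Literature.MathematicalPhysics.QuantumFieldTheory.BlockScaleEffectivePerturbation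

/-!
# Disproof work file for crux `RobustYangMills` (item stmt-QuantumFields-13897) — findings

Standing disprover (`cdisprove`) for the shared crux
`Summit.QuantumFields.QCD.Theses.NestedDissectionSea.RobustYangMills`
(verbatim `HeavyThresholdYMBridge.RobustYangMills`, `AdaptiveBlockFermions.RobustYangMills`;
rev-4 C′). Everything below is sorry-free and uses only tree objects. Sections:

* §0  small torus identities; the whole-torus polymer passes the range-control clause (h4)
      (`side_le_mul_card_blockCorners`, `rangeControl_of_side_le`) — **(h4) is not a locality
      condition for large polymers**: only the weight `e^{κ|X|}` inside (h3) prices them;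
      odd-torus reflection positivity in D1's format (`isReflectionPositive_zero_odd`).
* §1  `globalPert ρ hρ b g hg`: the legal D1 perturbation with ONE activity `g(S_W(U))` on the
      polymer of all block corners; its total, (h1) symmetries, (h4), and the perturbed measure in
      the two cases `gOne` (`μ_{β,W} = μ_{β₁}`: `perturbedMeasure_one`) and `gMix`
      (`μ_{β,W} = ½ μ_{β₁} + ½ μ_0`: `perturbedMeasure_mix`, `expectation_mix`).
* §2  (h2) for both (`isReflectionPositive_one/_mix`, from the tree's odd-torus OS positivity) and
      their connected correlations (`connectedCorr_one/_mix`).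
* §3  `G = SU(3)`: the plaquette species `P01`; `⟨P⟩_0 = 0` (`integral_P01_zero`, centre twist);
      `⟨P⟩_{β₁, 2S+1} ≥ m₀ > 0` uniformly in `S` for a small `β₁ > 0`
      (`exists_plaquette_mean_lower_bound`, tree `wilsonExpectation_plaquette_ge`).
* §4  **LOAD-BEARING ANALYSIS.** `RobustYangMillsNoSmall κ` = the crux body with the smallness
      clause (h3) `NormLE κ η` deleted; `robustYangMillsNoSmall_false : ∀ κ, ¬ …` — ANY PROOF OF
      THE CRUX MUST USE (h3) QUANTITATIVELY; (h1) ∧ (h2) ∧ (h4) do not constrain global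
      (mean-field / mixture) activities at all. Witness: the 50/50 mixture of the strong-coupling
      Wilson theory and the Haar theory has long-range order `¼⟨P⟩_{β₁}²` in the plaquette
      two-point function, against the uniform lattice gap (iii′).
* §5  `W ≡ 0` IS ADMISSIBLE (odd-torus RP is proved in the tree), so the crux implies
      `WilsonConsequences` (`robustYangMills_imp_wilson`): subsequential OS continuum limit with
      non-trivial non-Gaussian curvature, `HasMassGap Δ` and `HasLatticeMassGap Δ` for the PURE
      `SU(3)` Wilson theory along EVERY scaling sequence and every a.f. coupling sequence — Clay's problem (tree `ClayYangMillsEuclideanGap`, `SU(3)` case) plus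
      `β`-universality. The crux is therefore not refutable through `W ≡ 0` short of disproving
      Yang–Mills existence/mass gap.
* §6  (gen 2) **THE β-DIRECTION READING OF CLAUSE (iv).** The coupling shift `t • wilson ρ₃ hρ b`
      (tree `QuasiLocalGaugePerturbationWilson`) passes (h1)–(h4): lattice symmetries of `t·S_W`,
      odd-torus RP of `μ_{β+t}`, `‖t • wilson‖_{b,κ} ≤ t·288e^{3κ}b⁴`, and the NEW (h4) lemma for
      plaquette support polymers (`corner_succ_sub_val_le`, `rangeControl_plaquetteSupport`,
      `rangeControl_smul_wilson`). Hence `robustYangMills_imp_betaLipschitz`: the crux asserts, for the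
      SAME `W ≡ 0` witness `(φ, c, m, T, Δ)` that carries §5, that EVERY renormalised raw lattice moment
      `𝔐_k(β) = ∫ ∏ᵢ Φ^{σᵢ}(fᵢ) dμ_{2L_k+1,β}` — all `n`, all species strings, ALL smearings incl.
      coincident ones — is β-Lipschitz at `β'_k` with slope `C_{nσf} · 288 e^{3κ} ⌊ℓ₀/a_k⌋⁴` on
      `0 ≤ t ≤ η/(288e^{3κ}⌊ℓ₀/a_k⌋⁴)`, eventually in `k` (`WilsonBetaLipschitz`). File
      `Theorems/RobustYangMills/Negative/BetaLipschitz.lean` (proposed p79504). §6d: the energy budget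
      `|W(U) − W_∅| ≤ η · #blocks` for every real `U` (`abs_total_sub_act_empty_le`).

## Why the crux resists every cheap attack (for ideators / planners / the lead)

1. No junk: `NeZero (2S+1)` by the successor instance; `polymers b = 𝒫(blockCorners b)`;
   activities on non-polymers are ignored; `act ∅` is constant and cancels in the normalised
   measure; `expectation` is a Bochner integral against `Z⁻¹ • weight` with `0 < Z < ∞`
   (`partitionFunction_ne_zero_and_ne_top`); `W - W'` with `NormLE κ 0` has the same measure;
   `η = η₀ / max 1 (afBeta 0 Λ' ℓ₀) ∈ (0, η₀]` for every `ℓ₀` (junk `log` of non-positive numbers is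
   absorbed by `max 1`); `⌊ℓ₀/a_k⌋ ≥ 1`, `L_k ≥ 1`, `β'_k ≥ 0` eventually.
2. Every conclusion clause ((i′) convergence, non-triviality, non-Gaussianity, `HasMassGap`,
   (iii′), (iv)) is pinned to QUANTITATIVE expectations of `SU(3)` lattice Yang–Mills at
   `β'_k → ∞`; nothing there is computable, and (gen 2) THE CRUX'S OWN CLAUSES DO NOT PIN THE
   CURVATURE RENORMALISATION `c_k` beyond `liminf |c_k| > 0`: non-triviality + the trivial bound
   `|Cov(s̃_x, s̃_y)| ≤ ‖s̃‖²` give only that; (iii′) for `W ≡ 0` bounds time-separated covariances by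
   `C e^{-Δ a_k n}`, which at physical separation `n ≍ τ/a_k` is `O(1)`, not `O(a_k^p)` (and RP
   Cauchy–Schwarz makes it uniform in the transverse displacement but no smaller); the prover may set
   `c_σ ≡ 0` for every species but the curvature (a zero field is legal OS data), so only the
   curvature's `c_k` matters. Every (ii)/(iv)-side kill needs `|⟨s̃_0 ; s̃_x⟩_{β'_k}| ≲ |x|⁻⁴`
   uniformly in `k` — nonperturbative UV control of 4-d `SU(3)` — to force `c_k ≳ a_k⁻²`.
3. (h4) + "`Δ` chosen after `(ℓ₀, W)`": a coupling at lattice distance `n` needs `|X| ≥ n/b_k`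
   blocks, price `e^{κ n / b_k} = e^{(κ/ℓ₀) a_k n}`; the prover answers with `Δ ≤ κ/ℓ₀`. The
   global polymer passes (h4) (§0) but (h3) prices it `e^{-κ M⁴}`, far below `e^{-Δ a_k S}`.
4. (iii′)-side kills need PROVABLE long-range order from an `η`-per-block (energy budget `η` per
   `b_k⁴` sites, (h1)-symmetric, hence per-site strength `η b_k⁻⁴` for local densities), reflection
   positive perturbation of weakly coupled `SU(3)` on arbitrarily large tori: energy `η ≪ 1` per block
   against `O(1)` entropy per block degree of freedom — no mechanism (a weakly coupled block-spin
   system on top of YM does not order). Block-COHERENT tilts `g(block average)` would move block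
   statistics by `O(η)` in units of their fluctuation (`⟨s̃⟩` by `≍ η b_k⁻²`, i.e. `⟨Φ(f)⟩` by
   `≍ η g⁻² a_k⁻²` at canonical `c_k`), but they are not provably reflection positive: (h1a) forces
   translates straddling every time plane, and a nonlinear functional of a straddling cube is not of
   positive type; RP-compatible long-range pair couplings `∑ J(t'-t) Θv·v` need completely monotone
   `J` in TIME between thin time-slices, and (h1c) isotropy then forces slices extended in time
   (straddling again); sharp-interval products give the Hankel anti-diagonal `∑_j ΘP_j P_{N-j}`, not PSD;
   (h1a)-averaged block windows give the Hankel kernel `(b+1-(j+k))₊`, not PSD either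
   (`h(4)² > h(2)·h(6) = 0`). What IS admissible beyond coupling shifts (gen 2, positive example for
   ideators): PAIR couplings of single plaquettes `T = -∑_μ ∑_{p ⊥ μ} ∑_{r≥1} J(r) u_p u_{p+re_μ}`,
   `u_p = Re tr U_p`, `J(r) = ε e^{-m r}` — (h1) by construction, (h2) because time-displaced pairs of
   purely spatial plaquettes give the rank-one Hankel kernel `e^{-m(j+k-1)}` and equal-time pairs are
   both-on-one-side or both-straddling (Schur products of Osterwalder–Seiler's straddling plaquette
   factors), (h4) by carrying each pair on the straight chain of `⌈r/b_k⌉+1` blocks, (h3) iff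
   `ε ≲ η b_k⁻⁵` and `m ≥ 2κ/b_k` (physical range `ℓ₀/2κ`: (h4)'s tree-length pricing in action) — but
   the integrated coupling per plaquette is `∑_r J(r) ≍ ε/m ≍ η/(κ b_k⁴)`: irrelevant again. GENERAL
   REASON (a lemma a prover could formalise): for an (h1a)-invariant total `∑_v τ_v t` of a local term
   `t`, every block activity has `‖W_B‖_∞ ≥ b_k⁴ · sup_{U translation-invariant} |t(U)|`, so (h3) caps
   the coefficient of every local gauge-invariant term at `η b_k⁻⁴ ≍ η a_k⁴/ℓ₀⁴` (terms vanishing on all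
   translation-invariant configurations, e.g. squared gradients, are still caught by rough periodic
   configurations since the sup is over ALL real fields). The admissible cone is, in substance,
   "Wilson + irrelevant RP perturbations"; collective block functionals are the only escape from the
   per-site count and they are not reflection positive.
5. (iv) at `δ ≥ η` says MORE than Lipschitz: `sup_{W' admissible} |S_k(W') − S_k(0)| ≤ C_{nσf} η`
   — the renormalised moments (with Wilson's `c, m`) are uniformly bounded over the whole admissible
   cone. Physically harmless on `⁰𝒮`; at coincident smearings it inherits item 6.
6. **(iv) IS PHYSICALLY MISSTATED AT COINCIDENT SMEARINGS (near-miss; FLAG-clause-iv.md of the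
   crux-plan seat, sharpened in §6).** For `W ≡ 0`, `W' = t • wilson`, `t = δ/(288e^{3κ}b_k⁴) ≍ δ a_k⁴`:
   to leading order the `W'`-field is the `W`-field shifted by the c-number
   `Δμ = c_k ∫f · t ∂_β⟨s̃⟩ ≍ δ g_k²` (additive-counterterm mismatch; `∂_β⟨s̃⟩` = specific heat
   `≍ g⁴ > 0`), so `⟨Φ(f)³⟩_{W'} − ⟨Φ(f)³⟩_W ∋ 3 Δμ · Var Φ(f)` with the DIVERGENT coincident variance
   `Var Φ(f) ≍ c_k² a_k⁴ ‖f‖₂² χ ≍ a_k⁻⁴`: response `≍ δ g_k² a_k⁻⁴`, unbounded in `k`, against `C δ`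
   (equivalently: `∂_t 𝔐_k ≍ a_k⁻⁸ g_k²` against §6's slope `≍ a_k⁻⁴ ℓ₀⁴`). `n ≤ 2` passes
   (`n = 2` coincident: `ΔVar = c_k² a⁸ · a⁻⁴‖f‖² t ∂_βχ = O(δ g²)`), every `⁰𝒮` smearing passes.
   NOT Lean-refutable: needs `c_k ≍ a_k⁻⁴ g_k⁻²` (item 2) plus control of `Δκ₃`, `ΔVar` against
   cancellation. CLASS misstated; REPAIR (iv′): restrict (iv) to `n ≠ 0`, `IsTensorOf`/`IsOffDiagonal`
   smearings exactly as (i′) (the hankel skeleton's `OffDiagLipschitz`), or state it for bounded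
   un-renormalised cylinder observables, or for truncated moments. Every line inherits this defect
   until the planners restate (iv).
7. Dropping (h3): FALSE (§4). Dropping (h2) alone or (h4) alone: no provable witness exists
   without quantitative control of `SU(3)` Yang–Mills (the rev-3 range-`S` two-plaquette witness that
   motivated (h4) is first-order perturbation theory in `ε` with an uncontrolled `O(ε²)` remainder —
   a planner-level misstatement, not a Lean theorem). Dropping (h1): sparse one-plaquette-per-block
   couplings of strength `η` are then admissible and RP, but their effect is again density `a_k⁴/ℓ₀⁴`.

## Dead ends recorded
* time-translation-invariant `±1` observables would kill (iii′) at once, but species are LOCAL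
  cylinder functions (`LocalGaugeObservable`);
* the Haar theory (`W = -β' • wilson`, admissible without (h3)) violates non-triviality only
  through a Schwartz-space density argument (wrap-around terms × free renormalisations `c_k`);
* a Haar measure conditioned on "all plaquettes near `1`" gives long-range order but is not
  reflection positive (indicator kernels across the cut are not of positive type);
  the `β`-mixture of §4 is the reflection-positive replacement;
* (gen 2) a "fake non-triviality" by `c_k → 0`, `m_k = e_k − s₁/c_k` gives the CONSTANT field
  (`𝔖₂ = 𝔖₁𝔖₁`: not `IsNontrivial`); a CLT normalisation `c_k ≍ a_k⁻²` gives white noise (truncated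
  two-point function vanishes on `⁰𝒮`: not `IsNontrivial`) — `IsNontrivial` genuinely needs the YM
  two-point function at physical separation;
* (gen 2) variance-reducing block tilts (`ΔVar ≍ −η Var`) would bound `c_k ≲ a_k⁻²` via (iv) at
  `n = 2` coincident — same RP obstruction as item 4;
* (gen 2) the fundamental–adjoint bulk transition / critical endpoint (Bhanot–Creutz) is out of reach:
  it needs `O(1)` adjoint coupling per plaquette, admissible local densities have `O(η a_k⁴)`.

-- Targets (gen 2; registered skeleton `Lines/soft-absorption-balaban-cone.lean`, stubs
-- `stub_holomorphicAbsorption`, `stub_wilsonCore`, `stub_softAbsorptionUV`, `stub_infraredTail`;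
-- `stuck_stubs` empty, no PICKED.md yet):
-- * `stub_holomorphicAbsorption` — TRUE (classical): `K(·,x)` holomorphic on open `D ⊆ ℂᵐ`, `K(z,·)`
--   measurable, uniformly bounded, finite measure ⇒ `z ↦ ∫ K(z,x) dμ` holomorphic: a Carathéodory
--   function (continuous in `z` on separable `D`, measurable in `x`) is jointly measurable, so Fubini +
--   Morera give each variable, continuity by dominated convergence, Osgood for `m > 1`; `m = 0` trivial.
--   Not a target. (Prover hint: Mathlib `DifferentiableOn` via `hasFDerivAt_integral_of_dominated_of_fderiv_le`
--   with Cauchy estimates on polydiscs.)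
-- * `stub_wilsonCore` — the Clay core (`= WilsonConsequences` ∀ data); the crux implies it (§5), so
--   refuting it refutes the crux: open problem, not a target.
-- * `stub_softAbsorptionUV`, `stub_infraredTail` — both are IMPLICATIONS with `stub_wilsonCore` as a
--   hypothesis: `¬(A → B → C)` needs a proof of the Clay core. Irrefutable by construction. (Inside:
--   `LineBodyAt` is `∃ 𝔖`; the uninformative scheme satisfies (A) trivially and then (B) is killed by §4's
--   mixture — consistent, the prover picks an informative scheme; no scheme-independent kill found: an
--   "invisible direction" `N` with `E[e^{-N} − 1 | V] ≡ 0` would enlarge the absorbable cone but needs RP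
--   and weak-coupling control again.)
-- * (other lines, not registered) hankel `DiagonalExtension` (∀ washed witnesses, off-diagonal Lipschitz ⇒
--   full (iv)): believed FALSE by item 6 but its hypotheses (a NON-TRIVIAL washed witness of the Wilson
--   theory) cannot be instantiated without YM control — not refutable today; local-ac `KernelACInW`,
--   `KernelQuasiLocality`: paper-checked TRUE (ratio-of-tilts `e^{2δ|R|}`; (h4) ⇒ far-reaching polymers
--   through `R` have `≥ m+2` blocks, weight `≤ η e^{-κ(m+2)}` per block of `R`).
-/

noncomputable section

open MeasureTheory Filter Topology
open scoped ENNReal ComplexOrder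
open Literature.MathematicalPhysics.QuantumLattice Literature.MathematicalPhysics.AQFT
  Literature.MathematicalPhysics.QuantumFieldTheory

namespace Summit.QuantumFields.QCD.Cruxes.RobustYangMills.Disproof

/-! ## §0 Small identities on the torus -/

section Small

variable {d L N : ℕ} {G : Type*} [Group G]

/-- The `1 × 1` rectangle holonomy is the plaquette holonomy. [folklore] -/
theorem rectangleHolonomy_one_one (U : GaugeConfig d L G) (x : Site d L) (i j : Fin d) :
    rectangleHolonomy U x i j 1 1 = plaquetteHolonomy U x i j := by
  simp [rectangleHolonomy, lineHolonomy, plaquetteHolonomy, Site.shift]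

omit [Group G] in
/-- The crux's axis-permutation action is the tree's `configPerm`. [folklore] -/
theorem configPerm_eq [MeasurableSpace G] (π : Equiv.Perm (Fin d)) (U : GaugeConfig d L G) :
    (configPerm π U : GaugeConfig d L G) = fun e => U (e.1 ∘ π, π.symm e.2) := by
  funext e
  rw [configPerm_apply]
  rfl

variable [TopologicalSpace G] [IsTopologicalGroup G] [CompactSpace G]

/-- The Wilson action is invariant under the time reflection `Θ` (any torus size). [folklore] -/
theorem wilsonAction_timeReflect [NeZero d] [NeZero L] (ρ : G →* Matrix (Fin N) (Fin N) ℂ)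
    (hρ : Continuous ρ) (U : GaugeConfig d L G) :
    wilsonAction ρ U.timeReflect = wilsonAction ρ U := by
  unfold wilsonAction
  have h : ∀ p : Plaquette d L,
      (ρ (plaquetteHolonomy U.timeReflect p.1 p.2.1.1 p.2.1.2)).trace.re =
        (ρ (plaquetteHolonomy U (WilsonRP.plaqReflect p).1 (WilsonRP.plaqReflect p).2.1.1
          (WilsonRP.plaqReflect p).2.1.2)).trace.re :=
    fun p => WilsonRP.plaqRe_timeReflect ρ hρ U p
  simp_rw [h]
  exact Fintype.sum_equiv WilsonRP.plaqReflectEquiv _ _ (fun p => rfl)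

variable [MeasurableSpace G] [BorelSpace G]

/-- At `β = 0` the torus Wilson measure is the Haar product (any `d`, `L`; cf. the `d = 4`,
universe-`0` version `wilsonMeasure_zero_coupling` of the YangMills negative files). [folklore] -/
theorem wilsonMeasure_zero_eq_pi [NeZero L] (ρ : G →* Matrix (Fin N) (Fin N) ℂ) :
    wilsonMeasure (d := d) (L := L) ρ 0 = Measure.pi fun _ : Edge d L => haarProbability G := by
  have hW : wilsonWeight (d := d) (L := L) ρ 0 = Measure.pi fun _ : Edge d L => haarProbability G := by
    have h1 : (fun U : GaugeConfig d L G => ENNReal.ofReal (Real.exp (-0 * wilsonAction ρ U))) = 1 := by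
      funext U; simp
    simp only [wilsonWeight, h1, withDensity_one]
  have hZ : partitionFunction (d := d) (L := L) ρ 0 = 1 := by
    simp only [partitionFunction, hW, measure_univ]
  rw [wilsonMeasure, hZ, hW, inv_one, one_smul]

/-- The torus partition function is neither `0` nor `∞` (continuous `ρ`). [folklore] -/
theorem partitionFunction_ne_zero_and_ne_top [NeZero L] (ρ : G →* Matrix (Fin N) (Fin N) ℂ)
    (hρ : Continuous ρ) (β : ℝ) :
    partitionFunction (d := d) (L := L) ρ β ≠ 0 ∧ partitionFunction (d := d) (L := L) ρ β ≠ ∞ := by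
  haveI := isProbabilityMeasure_wilsonMeasure (d := d) (L := L) ρ hρ β
  have h1 : wilsonMeasure (d := d) (L := L) ρ β Set.univ = 1 := measure_univ
  have h2 : wilsonMeasure (d := d) (L := L) ρ β Set.univ =
      (partitionFunction (d := d) (L := L) ρ β)⁻¹ * partitionFunction (d := d) (L := L) ρ β := by
    simp [wilsonMeasure, partitionFunction]
  rw [h2] at h1
  constructor
  · intro h0; rw [h0] at h1; simp at h1
  · intro ht; rw [ht] at h1; simp at h1

end Small

/-! ## §0b Block corners: the whole-torus polymer passes the range-control clause (h4) -/

section Corners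

variable {L : ℕ} [NeZero L]

/-- There are at least `⌈L/b⌉` block corners, so `L ≤ b · #corners` for `b ≥ 1`: the range-control
clause (h4) of the crux is satisfied by the polymer of ALL block corners. [folklore] -/
theorem side_le_mul_card_blockCorners {b : ℕ} (hb : 1 ≤ b) :
    L ≤ b * (blockCorners (d := 4) (L := L) b).card := by
  classical
  set q : ℕ := (L - 1) / b + 1 with hq
  -- the corners `(m b, 0, 0, 0)`, `m < q`
  let f : ℕ → Site 4 L := fun m => Pi.single 0 (((m * b : ℕ) : ZMod L))
  have hL : 0 < L := Nat.pos_of_ne_zero (NeZero.ne L)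
  have hmb : ∀ m, m < q → m * b < L := by
    intro m hm
    have hm' : m ≤ (L - 1) / b := Nat.lt_succ_iff.1 hm
    calc m * b ≤ (L - 1) / b * b := Nat.mul_le_mul_right _ hm'
      _ ≤ L - 1 := Nat.div_mul_le_self _ _
      _ < L := Nat.sub_lt hL one_pos
  have hval : ∀ m, m < q → (f m 0).val = m * b := by
    intro m hm
    simp only [f, Pi.single_eq_same, ZMod.val_natCast]
    exact Nat.mod_eq_of_lt (hmb m hm)
  have hmem : ∀ m, m < q → f m ∈ blockCorners (d := 4) (L := L) b := by
    intro m hm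
    rw [mem_blockCorners_iff]
    intro i
    by_cases hi : i = 0
    · subst hi; rw [hval m hm]; exact Dvd.intro_left _ rfl
    · simp [f, hi]
  have hinj : Set.InjOn f ↑(Finset.range q) := by
    intro m hm m' hm' hmm'
    have hmq : m < q := Finset.mem_range.1 hm
    have hmq' : m' < q := Finset.mem_range.1 hm'
    have := congrArg (fun x : Site 4 L => (x 0).val) hmm'
    rw [hval m hmq, hval m' hmq'] at this
    exact Nat.eq_of_mul_eq_mul_right (by omega) this
  have hcard : q ≤ (blockCorners (d := 4) (L := L) b).card := by
    calc q = (Finset.range q).card := (Finset.card_range q).symm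
      _ = ((Finset.range q).image f).card := (Finset.card_image_of_injOn hinj).symm
      _ ≤ _ := Finset.card_le_card (fun x hx => by
          obtain ⟨m, hm, rfl⟩ := Finset.mem_image.1 hx
          exact hmem m (Finset.mem_range.1 hm))
  have hbq : L ≤ b * q := by
    have := Nat.div_add_mod (L - 1) b
    have hmod : (L - 1) % b < b := Nat.mod_lt _ (by omega)
    have e1 : b * q = b * ((L - 1) / b) + b := by rw [hq]; ring
    rw [e1]
    generalize (L - 1) / b = t at this ⊢
    generalize (L - 1) % b = r at this hmod
    generalize b * t = bt at this ⊢
    omega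
  exact hbq.trans (Nat.mul_le_mul_left _ hcard)

/-- On the torus of side `L`, every one-sided `ZMod` difference has representative `< L`, hence
the range-control disjunction holds as soon as `L ≤ b · |X|`. [folklore] -/
theorem rangeControl_of_side_le {b : ℕ} {X : Finset (Site 4 L)} (h : L ≤ b * X.card)
    (y y' : Site 4 L) (i : Fin 4) :
    (y i - y' i).val ≤ b * X.card ∨ (y' i - y i).val ≤ b * X.card :=
  Or.inl ((ZMod.val_lt _).le.trans h)

end Corners

/-! ## §0c Odd-torus reflection positivity of the unperturbed theory in D1's format -/

section OddRP

variable {G : Type*} [Group G] [TopologicalSpace G] [IsTopologicalGroup G] [CompactSpace G]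
  [MeasurableSpace G] [BorelSpace G] {N : ℕ} (ρ : G →* Matrix (Fin N) (Fin N) ℂ)

omit [Group G] [TopologicalSpace G] [IsTopologicalGroup G] [CompactSpace G] [MeasurableSpace G]
  [BorelSpace G] in
/-- A positive-time observable (Wave 0's `IsPositiveTimeObservable`) depends only on the links
`P ∪ M` of the odd-torus reflection-positivity theorem. [folklore] -/
theorem dependsOn_of_isPositiveTimeObservable {d L : ℕ} [NeZero d] [NeZero L] {α : Type*}
    {F : GaugeConfig d L G → α} (hF : IsPositiveTimeObservable F) :
    DependsOn F ((WilsonOddRP.oPosEdges ∪ WilsonOddRP.oSharedEdges : Finset (Edge d L)) :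
      Set (Edge d L)) := by
  intro U V hUV
  refine hF U V fun e h1 h2 _ _ => hUV e ?_
  rw [Finset.coe_union]
  exact Or.inl (Finset.mem_coe.2 (WilsonOddRP.mem_oPosEdges.2 (show WilsonOddRP.IsOPosEdge e from ⟨h1, h2⟩)))

/-- Osterwalder–Seiler positivity of `⟨conj F(ΘU) F(U)⟩_{2S+1, β}`, `β ≥ 0`, `S ≥ 1`. [folklore] -/
theorem wilsonExpectation_oddRP {S : ℕ} (hS : 1 ≤ S) (hρ : Continuous ρ) {β : ℝ} (hβ : 0 ≤ β)
    (F : GaugeConfig 4 (2 * S + 1) G → ℂ) (hF : Measurable F) (hFb : ∃ C : ℝ, ∀ U, ‖F U‖ ≤ C)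
    (hFpos : IsPositiveTimeObservable F) :
    0 ≤ wilsonExpectation (d := 4) (L := 2 * S + 1) ρ β fun U =>
      (starRingEnd ℂ) (F U.timeReflect) * F U :=
  wilsonExpectation_oddReflectionPositive ρ ⟨S, by ring⟩ (by omega) hρ hβ F hF hFb
    (dependsOn_of_isPositiveTimeObservable hFpos)

/-- `W ≡ 0` is reflection positive in D1's sense on every odd torus `2S+1`, `S ≥ 1`, `β ≥ 0`. [folklore] -/
theorem isReflectionPositive_zero_odd {S : ℕ} (hS : 1 ≤ S) (hρ : Continuous ρ) {β : ℝ}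
    (hβ : 0 ≤ β) (b : ℕ) :
    (0 : QuasiLocalGaugePerturbation 4 (2 * S + 1) G b).IsReflectionPositive ρ β := by
  intro F hF hFb hFpos
  rw [QuasiLocalGaugePerturbation.expectation_zero]
  exact wilsonExpectation_oddRP ρ hS hρ hβ F hF hFb hFpos

/-- On the one-site torus (`S = 0`) every positive-time observable is constant, so `W ≡ 0` is
reflection positive there for trivial reasons. [folklore] -/
theorem isReflectionPositive_zero_one (hρ : Continuous ρ) (β : ℝ) (b : ℕ) :
    (0 : QuasiLocalGaugePerturbation 4 (2 * 0 + 1) G b).IsReflectionPositive ρ β := by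
  intro F hF hFb hFpos
  have hconst : ∀ U V : GaugeConfig 4 (2 * 0 + 1) G, F U = F V := fun U V =>
    hFpos U V fun e h1 h2 _ _ => by omega
  rw [QuasiLocalGaugePerturbation.expectation_zero]
  unfold wilsonExpectation
  have hfun : (fun U : GaugeConfig 4 (2 * 0 + 1) G => (starRingEnd ℂ) (F U.timeReflect) * F U) =
      fun _ => (starRingEnd ℂ) (F 1) * F 1 := by
    funext U; rw [hconst U.timeReflect 1, hconst U 1]
  haveI := isProbabilityMeasure_wilsonMeasure (d := 4) (L := 2 * 0 + 1) ρ hρ β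
  rw [hfun, integral_const, probReal_univ, one_smul]
  exact star_mul_self_nonneg (F 1)

/-- **`W ≡ 0` is reflection positive in D1's sense on EVERY odd torus `2S+1`, `β ≥ 0`** — this
discharges the hypothesis `hRP` of the tree's
`SeaFactorisationBridge.Negative.yangMillsSU3_of_robustYangMills`, which thereby becomes
unconditional. [folklore] -/
theorem isReflectionPositive_zero_all (hρ : Continuous ρ) (S b : ℕ) {β : ℝ} (hβ : 0 ≤ β) :
    (0 : QuasiLocalGaugePerturbation 4 (2 * S + 1) G b).IsReflectionPositive ρ β := by
  rcases Nat.eq_zero_or_pos S with rfl | hS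
  · exact isReflectionPositive_zero_one ρ hρ β b
  · exact isReflectionPositive_zero_odd ρ hS hρ hβ b

end OddRP


/-! ## §1 The global one-activity perturbation `X_all ↦ g(S_W(U))` -/

section Global

variable {G : Type*} [Group G] [TopologicalSpace G] [IsTopologicalGroup G] [CompactSpace G]
  [MeasurableSpace G] [BorelSpace G] [SecondCountableTopology G] {N : ℕ}
  (ρ : G →* Matrix (Fin N) (Fin N) ℂ) (hρ : Continuous ρ)

variable {Lt : ℕ} [NeZero Lt]

/-- The quasi-local perturbation with a SINGLE non-zero activity, carried by the polymer of all
block corners (the whole torus) and equal to `g(S_W(U))` for a continuous `g : ℝ → ℝ`. It is a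
legitimate member of D1's class (cylinder: all links; gauge invariant; measurable; bounded). [folklore] -/
def globalPert (b : ℕ) (g : ℝ → ℝ) (hg : Continuous g) : QuasiLocalGaugePerturbation 4 Lt G b where
  act X U := if X = blockCorners b then g (wilsonAction ρ U) else 0
  dependsOn' X := by
    intro U V hUV
    by_cases hX : X = blockCorners b
    · have hUV' : U = V := funext fun e => hUV e (by
        rw [Finset.mem_coe, mem_polymerEdges_iff, hX]
        exact mem_blockCorners_iff.2 (isBlockAligned_blockCorner b e.1))
      rw [hUV']
    · simp [hX]
  gaugeInvariant' X := by
    intro gauge U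
    by_cases hX : X = blockCorners b
    · simp only [hX, ↓reduceIte, wilsonAction_gaugeTransform]
    · simp [hX]
  measurable' X := by
    by_cases hX : X = blockCorners b
    · simp only [hX, ↓reduceIte]
      exact (hg.comp (continuous_wilsonAction ρ hρ)).measurable
    · simp only [hX, ↓reduceIte]
      exact measurable_const
  bounded' X := by
    by_cases hX : X = blockCorners b
    · obtain ⟨C, hC⟩ := (isCompact_univ.image
        (continuous_abs.comp (hg.comp (continuous_wilsonAction (d := 4) (L := Lt) ρ hρ)))).isBounded.bddAbove
      refine ⟨C, fun U => ?_⟩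
      simp only [hX, ↓reduceIte]
      exact hC ⟨U, Set.mem_univ _, rfl⟩
    · exact ⟨0, fun U => by simp [hX]⟩

variable {ρ hρ}

/-- The activity of the global perturbation. [folklore] -/
@[simp] theorem globalPert_act (b : ℕ) (g : ℝ → ℝ) (hg : Continuous g) (X : Finset (Site 4 Lt))
    (U : GaugeConfig 4 Lt G) :
    (globalPert ρ hρ b g hg).act X U = if X = blockCorners b then g (wilsonAction ρ U) else 0 := rfl

/-- Its total is `g(S_W(U))`. [folklore] -/
theorem total_globalPert (b : ℕ) (g : ℝ → ℝ) (hg : Continuous g) (U : GaugeConfig 4 Lt G) :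
    (globalPert ρ hρ b g hg).total U = g (wilsonAction ρ U) := by
  simp [QuasiLocalGaugePerturbation.total, Finset.sum_ite_eq', mem_polymers_iff]

/-- (h1a) the total is invariant under all torus translations. [folklore] -/
theorem total_globalPert_shift (b : ℕ) (g : ℝ → ℝ) (hg : Continuous g) (v : Site 4 Lt)
    (U : GaugeConfig 4 Lt G) :
    (globalPert ρ hρ b g hg).total (torusConfigShift v U) = (globalPert ρ hρ b g hg).total U := by
  rw [total_globalPert, total_globalPert, wilsonAction_torusConfigShift]

/-- (h1b) the total is invariant under the time reflection. [folklore] -/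
theorem total_globalPert_timeReflect (b : ℕ) (g : ℝ → ℝ) (hg : Continuous g)
    (U : GaugeConfig 4 Lt G) :
    (globalPert ρ hρ b g hg).total (GaugeConfig.timeReflect U) = (globalPert ρ hρ b g hg).total U := by
  rw [total_globalPert, total_globalPert, wilsonAction_timeReflect ρ hρ]

/-- (h1c) the total is invariant under all axis permutations. [folklore] -/
theorem total_globalPert_perm (b : ℕ) (g : ℝ → ℝ) (hg : Continuous g) (π : Equiv.Perm (Fin 4))
    (U : GaugeConfig 4 Lt G) :
    (globalPert ρ hρ b g hg).total (fun e => U (e.1 ∘ π, π.symm e.2)) =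
      (globalPert ρ hρ b g hg).total U := by
  rw [← configPerm_eq, total_globalPert, total_globalPert, wilsonAction_configPerm ρ hρ]

/-- (h4) range control: the only activity-carrying polymer is the whole torus, and
`2S+1 ≤ b · #corners`. [folklore] -/
theorem rangeControl_globalPert {b : ℕ} (hb : 1 ≤ b) (g : ℝ → ℝ) (hg : Continuous g)
    (X : Finset (Site 4 Lt)) (hne : ∃ U : GaugeConfig 4 Lt G, (globalPert ρ hρ b g hg).act X U ≠ 0)
    (y : Site 4 Lt) (_hy : y ∈ X) (y' : Site 4 Lt) (_hy' : y' ∈ X) (i : Fin 4) :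
    (y i - y' i).val ≤ b * X.card ∨ (y' i - y i).val ≤ b * X.card := by
  have hX : X = blockCorners b := by
    by_contra h
    obtain ⟨U, hU⟩ := hne
    exact hU (by simp [h])
  subst hX
  exact rangeControl_of_side_le (side_le_mul_card_blockCorners hb) y y' i

/-- The perturbed weight of the global perturbation. [folklore] -/
theorem weight_globalPert (b : ℕ) (g : ℝ → ℝ) (hg : Continuous g) (β : ℝ) :
    (globalPert ρ hρ b g hg).weight ρ β =
      (Measure.pi fun _ : Edge 4 Lt => haarProbability G).withDensity
        fun U => ENNReal.ofReal (Real.exp (-β * wilsonAction ρ U - g (wilsonAction ρ U))) := by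
  unfold QuasiLocalGaugePerturbation.weight
  congr 1
  funext U
  rw [total_globalPert]

/-! ### Case ONE: `g(s) = (β₁ - β) s` — the pure Wilson theory at coupling `β₁` -/

/-- `g(s) = (β₁ - β) s`: shifts the coupling from `β` to `β₁`. [folklore] -/
def gOne (β β₁ : ℝ) : ℝ → ℝ := fun s => (β₁ - β) * s

/-- `gOne` is continuous. [folklore] -/
theorem continuous_gOne (β β₁ : ℝ) : Continuous (gOne β β₁) := by
  unfold gOne; fun_prop

/-- With `g = gOne β β₁` the perturbed measure at coupling `β` IS the Wilson measure at `β₁`. [folklore] -/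
theorem perturbedMeasure_one (b : ℕ) (β β₁ : ℝ) :
    (globalPert ρ hρ b (gOne β β₁) (continuous_gOne β β₁)).perturbedMeasure ρ β =
      wilsonMeasure (d := 4) (L := Lt) ρ β₁ := by
  have hw : (globalPert ρ hρ b (gOne β β₁) (continuous_gOne β β₁)).weight ρ β =
      wilsonWeight (d := 4) (L := Lt) ρ β₁ := by
    rw [weight_globalPert]
    unfold wilsonWeight
    congr 1
    funext U
    congr 2
    simp only [gOne]
    ring
  unfold QuasiLocalGaugePerturbation.perturbedMeasure QuasiLocalGaugePerturbation.partitionFunction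
    wilsonMeasure partitionFunction
  rw [hw]

/-! ### Case MIX: `g(s) = -β s - log(e^{-β₁ s} + z₁)` — the 50/50 mixture of `μ_{β₁}` and Haar -/

/-- `g(s) = -β s - log (exp (-β₁ s) + z)`: turns `e^{-β S}` into `e^{-β₁ S} + z`. [folklore] -/
def gMix (β β₁ z : ℝ) : ℝ → ℝ := fun s => -β * s - Real.log (Real.exp (-β₁ * s) + z)

/-- `e^{-β₁ s} + z > 0` for `z ≥ 0`. [folklore] -/
theorem exp_add_pos (β₁ z : ℝ) (hz : 0 ≤ z) (s : ℝ) : 0 < Real.exp (-β₁ * s) + z :=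
  add_pos_of_pos_of_nonneg (Real.exp_pos _) hz

/-- `gMix` is continuous (`z ≥ 0`). [folklore] -/
theorem continuous_gMix (β β₁ z : ℝ) (hz : 0 ≤ z) : Continuous (gMix β β₁ z) := by
  unfold gMix
  refine (continuous_const.mul continuous_id).sub ?_
  exact Continuous.log (by fun_prop) fun s => (exp_add_pos β₁ z hz s).ne'

/-- With `g = gMix β β₁ z₁`, `z₁ = Z_{β₁}`, the perturbed measure at coupling `β` is the mixture
`½ μ_{β₁} + ½ μ_0`. [folklore] -/
theorem perturbedMeasure_mix (b : ℕ) (β β₁ : ℝ) :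
    (globalPert ρ hρ b (gMix β β₁ (partitionFunction (d := 4) (L := Lt) ρ β₁).toReal)
        (continuous_gMix β β₁ _ ENNReal.toReal_nonneg)).perturbedMeasure ρ β =
      (2⁻¹ : ℝ≥0∞) • wilsonMeasure (d := 4) (L := Lt) ρ β₁ +
        (2⁻¹ : ℝ≥0∞) • wilsonMeasure (d := 4) (L := Lt) ρ 0 := by
  set Z₁ : ℝ≥0∞ := partitionFunction (d := 4) (L := Lt) ρ β₁ with hZ₁
  obtain ⟨hZ0, hZt⟩ := partitionFunction_ne_zero_and_ne_top (d := 4) (L := Lt) ρ hρ β₁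
  set π₀ : Measure (GaugeConfig 4 Lt G) := Measure.pi fun _ : Edge 4 Lt => haarProbability G with hπ₀
  have hmeasS : Measurable fun U : GaugeConfig 4 Lt G => ENNReal.ofReal (Real.exp (-β₁ * wilsonAction ρ U)) :=
    ENNReal.measurable_ofReal.comp ((continuous_wilsonAction ρ hρ).measurable.const_mul (-β₁)).exp
  -- the weight is `wilsonWeight β₁ + Z₁ • π₀`
  have hw : (globalPert ρ hρ b (gMix β β₁ Z₁.toReal)
      (continuous_gMix β β₁ _ ENNReal.toReal_nonneg)).weight ρ β =
      wilsonWeight (d := 4) (L := Lt) ρ β₁ + Z₁ • π₀ := by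
    rw [weight_globalPert]
    have hdens : (fun U : GaugeConfig 4 Lt G => ENNReal.ofReal
        (Real.exp (-β * wilsonAction ρ U - gMix β β₁ Z₁.toReal (wilsonAction ρ U)))) =
        (fun U => ENNReal.ofReal (Real.exp (-β₁ * wilsonAction ρ U))) + fun _ => Z₁ := by
      funext U
      simp only [Pi.add_apply, gMix]
      rw [show -β * wilsonAction ρ U - (-β * wilsonAction ρ U -
          Real.log (Real.exp (-β₁ * wilsonAction ρ U) + Z₁.toReal)) =
          Real.log (Real.exp (-β₁ * wilsonAction ρ U) + Z₁.toReal) by ring,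
        Real.exp_log (exp_add_pos β₁ _ ENNReal.toReal_nonneg _),
        ENNReal.ofReal_add (Real.exp_pos _).le ENNReal.toReal_nonneg, ENNReal.ofReal_toReal hZt]
    rw [hdens, withDensity_add_left hmeasS, withDensity_const]
    rfl
  have hZW : (globalPert (Lt := Lt) ρ hρ b (gMix β β₁ Z₁.toReal)
      (continuous_gMix β β₁ _ ENNReal.toReal_nonneg)).partitionFunction ρ β = 2 * Z₁ := by
    unfold QuasiLocalGaugePerturbation.partitionFunction
    have hπu : π₀ Set.univ = 1 := by rw [hπ₀]; exact measure_univ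
    rw [hw, Measure.add_apply, Measure.smul_apply, hπu, smul_eq_mul, mul_one]
    change Z₁ + Z₁ = 2 * Z₁
    rw [two_mul]
  unfold QuasiLocalGaugePerturbation.perturbedMeasure
  rw [hZW, hw, smul_add, smul_smul, ENNReal.mul_inv (Or.inl two_ne_zero) (Or.inl ENNReal.ofNat_ne_top),
    mul_assoc, ENNReal.inv_mul_cancel hZ0 hZt, mul_one]
  congr 1
  · unfold wilsonMeasure
    rw [smul_smul]
  · rw [wilsonMeasure_zero_eq_pi (d := 4) (L := Lt) ρ]

/-- Expectations under the mixture split. [folklore] -/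
theorem expectation_mix {V : Type*} [NormedAddCommGroup V] [NormedSpace ℝ V] [CompleteSpace V]
    (b : ℕ) (β β₁ : ℝ)
    (f : GaugeConfig 4 Lt G → V) (h₁ : Integrable f (wilsonMeasure (d := 4) (L := Lt) ρ β₁))
    (h₀ : Integrable f (wilsonMeasure (d := 4) (L := Lt) ρ 0)) :
    (globalPert ρ hρ b (gMix β β₁ (partitionFunction (d := 4) (L := Lt) ρ β₁).toReal)
        (continuous_gMix β β₁ _ ENNReal.toReal_nonneg)).expectation ρ β f =
      (2⁻¹ : ℝ) • (∫ U, f U ∂(wilsonMeasure (d := 4) (L := Lt) ρ β₁)) +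
        (2⁻¹ : ℝ) • ∫ U, f U ∂(wilsonMeasure (d := 4) (L := Lt) ρ 0) := by
  unfold QuasiLocalGaugePerturbation.expectation
  rw [perturbedMeasure_mix, integral_add_measure (h₁.smul_measure (by simp)) (h₀.smul_measure (by simp)),
    integral_smul_measure, integral_smul_measure]
  norm_num

end Global

/-! ## §2 Reflection positivity (h2) of the two global witnesses and their connected correlations -/

section RP

variable {G : Type} [Group G] [TopologicalSpace G] [IsTopologicalGroup G] [CompactSpace G]
  [MeasurableSpace G] [BorelSpace G] [SecondCountableTopology G] {N : ℕ}
  {ρ : G →* Matrix (Fin N) (Fin N) ℂ} {hρ : Continuous ρ}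

omit [SecondCountableTopology G] in
/-- Bounded measurable `conj F(ΘU) F(U)` is integrable for every torus Wilson measure. [folklore] -/
theorem integrable_rpObs (hρ : Continuous ρ) {S : ℕ} (β : ℝ)
    (F : GaugeConfig 4 (2 * S + 1) G → ℂ) (hF : Measurable F) {C : ℝ} (hC : ∀ U, ‖F U‖ ≤ C) :
    Integrable (fun U => (starRingEnd ℂ) (F U.timeReflect) * F U)
      (wilsonMeasure (d := 4) (L := 2 * S + 1) ρ β) := by
  haveI := isProbabilityMeasure_wilsonMeasure (d := 4) (L := 2 * S + 1) ρ hρ β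
  refine Integrable.of_bound ?_ (C * C) (Eventually.of_forall fun U => ?_)
  · exact ((Complex.continuous_conj.measurable.comp (hF.comp WilsonRP.measurable_timeReflect)).mul
      hF).aestronglyMeasurable
  · rw [norm_mul, Complex.norm_conj]
    exact mul_le_mul (hC U.timeReflect) (hC U) (norm_nonneg (F U))
      ((norm_nonneg (F U)).trans (hC U))

omit [SecondCountableTopology G] in
/-- A bounded measurable real observable of the periodic lift is integrable. [folklore] -/
theorem integrable_lift (hρ : Continuous ρ) {Lt : ℕ} [NeZero Lt] (β : ℝ)
    {f : GaugeConfig 4 Lt G → ℝ} (hf : Measurable f) {C : ℝ} (hC : ∀ U, |f U| ≤ C) :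
    Integrable f (wilsonMeasure (d := 4) (L := Lt) ρ β) := by
  haveI := isProbabilityMeasure_wilsonMeasure (d := 4) (L := Lt) ρ hρ β
  exact Integrable.of_bound hf.aestronglyMeasurable C
    (Eventually.of_forall fun U => by rw [Real.norm_eq_abs]; exact hC U)

/-- (h2) for case ONE (`β₁ ≥ 0`): the perturbed measure is `μ_{β₁}`, reflection positive on the
odd torus by the tree's Osterwalder–Seiler theorem. [folklore] -/
theorem isReflectionPositive_one (hρ : Continuous ρ) {S : ℕ} (hS : 1 ≤ S) (b : ℕ) (β : ℝ)
    {β₁ : ℝ} (hβ₁ : 0 ≤ β₁) :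
    (globalPert (Lt := 2 * S + 1) ρ hρ b (gOne β β₁) (continuous_gOne β β₁)).IsReflectionPositive
      ρ β := by
  intro F hF hFb hFpos
  unfold QuasiLocalGaugePerturbation.expectation
  rw [perturbedMeasure_one]
  exact wilsonExpectation_oddRP ρ hS hρ hβ₁ F hF hFb hFpos

/-- (h2) for case MIX (`β₁ ≥ 0`): a 50/50 mixture of two reflection-positive measures is
reflection positive. [folklore] -/
theorem isReflectionPositive_mix (hρ : Continuous ρ) {S : ℕ} (hS : 1 ≤ S) (b : ℕ) (β : ℝ)
    {β₁ : ℝ} (hβ₁ : 0 ≤ β₁) :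
    (globalPert (Lt := 2 * S + 1) ρ hρ b
      (gMix β β₁ (partitionFunction (d := 4) (L := 2 * S + 1) ρ β₁).toReal)
      (continuous_gMix β β₁ _ ENNReal.toReal_nonneg)).IsReflectionPositive ρ β := by
  intro F hF hFb hFpos
  obtain ⟨C, hC⟩ := hFb
  rw [expectation_mix b β β₁ _ (integrable_rpObs hρ β₁ F hF hC) (integrable_rpObs hρ 0 F hF hC)]
  have h1 := wilsonExpectation_oddRP ρ hS hρ hβ₁ F hF ⟨C, hC⟩ hFpos
  have h0 := wilsonExpectation_oddRP ρ hS hρ le_rfl F hF ⟨C, hC⟩ hFpos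
  unfold wilsonExpectation at h1 h0
  rw [Complex.real_smul, Complex.real_smul]
  have h2 : (0 : ℂ) ≤ ((2⁻¹ : ℝ) : ℂ) := Complex.zero_le_real.2 (by norm_num)
  exact add_nonneg (mul_nonneg h2 h1) (mul_nonneg h2 h0)

/-- Connected correlations of case ONE are the Wilson ones at `β₁`. [folklore] -/
theorem connectedCorr_one {S : ℕ} (b : ℕ) (β β₁ : ℝ) (A B : LGConfig 4 G → ℝ) (n : ℕ) :
    (globalPert (Lt := 2 * S + 1) ρ hρ b (gOne β β₁) (continuous_gOne β β₁)).connectedCorr ρ β A B n =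
      latticeConnectedCorr ρ β₁ (2 * S + 1) A B n := by
  unfold QuasiLocalGaugePerturbation.connectedCorr QuasiLocalGaugePerturbation.expectation
    latticeConnectedCorr
  rw [perturbedMeasure_one]

/-- Connected correlations of case MIX in terms of Wilson integrals at `β₁` and `0`. [folklore] -/
theorem connectedCorr_mix (hρ : Continuous ρ) {S : ℕ} (b : ℕ) (β β₁ : ℝ) (A B : YMSpecies G) (n : ℕ) :
    (globalPert (Lt := 2 * S + 1) ρ hρ b
      (gMix β β₁ (partitionFunction (d := 4) (L := 2 * S + 1) ρ β₁).toReal)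
      (continuous_gMix β β₁ _ ENNReal.toReal_nonneg)).connectedCorr ρ β A.F B.F n =
    (2⁻¹ * (∫ U, A.F (torusLift (2 * S + 1) U) *
        B.F (configShift (-Pi.single 0 (n : ℤ)) (torusLift (2 * S + 1) U))
          ∂(wilsonMeasure (d := 4) (L := 2 * S + 1) ρ β₁)) +
      2⁻¹ * (∫ U, A.F (torusLift (2 * S + 1) U) *
        B.F (configShift (-Pi.single 0 (n : ℤ)) (torusLift (2 * S + 1) U))
          ∂(wilsonMeasure (d := 4) (L := 2 * S + 1) ρ 0))) -
    (2⁻¹ * (∫ U, A.F (torusLift (2 * S + 1) U) ∂(wilsonMeasure (d := 4) (L := 2 * S + 1) ρ β₁)) +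
      2⁻¹ * (∫ U, A.F (torusLift (2 * S + 1) U) ∂(wilsonMeasure (d := 4) (L := 2 * S + 1) ρ 0))) *
    (2⁻¹ * (∫ U, B.F (torusLift (2 * S + 1) U) ∂(wilsonMeasure (d := 4) (L := 2 * S + 1) ρ β₁)) +
      2⁻¹ * (∫ U, B.F (torusLift (2 * S + 1) U) ∂(wilsonMeasure (d := 4) (L := 2 * S + 1) ρ 0))) := by
  obtain ⟨CA, hCA⟩ := A.bounded
  obtain ⟨CB, hCB⟩ := B.bounded
  have hmA : Measurable fun U : GaugeConfig 4 (2 * S + 1) G => A.F (torusLift (2 * S + 1) U) :=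
    A.measurable.comp (measurable_torusLift _)
  have hmB : Measurable fun U : GaugeConfig 4 (2 * S + 1) G =>
      B.F (configShift (-Pi.single 0 (n : ℤ)) (torusLift (2 * S + 1) U)) :=
    B.measurable.comp ((configShift _).measurable.comp (measurable_torusLift _))
  have hmAB : Measurable fun U : GaugeConfig 4 (2 * S + 1) G => A.F (torusLift (2 * S + 1) U) *
      B.F (configShift (-Pi.single 0 (n : ℤ)) (torusLift (2 * S + 1) U)) := hmA.mul hmB
  have hbAB : ∀ U : GaugeConfig 4 (2 * S + 1) G, |A.F (torusLift (2 * S + 1) U) *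
      B.F (configShift (-Pi.single 0 (n : ℤ)) (torusLift (2 * S + 1) U))| ≤ CA * CB := fun U => by
    rw [abs_mul]
    exact mul_le_mul (hCA _) (hCB _) (abs_nonneg _)
      ((abs_nonneg (A.F (torusLift (2 * S + 1) U))).trans (hCA _))
  have hmB' : Measurable fun U : GaugeConfig 4 (2 * S + 1) G => B.F (torusLift (2 * S + 1) U) :=
    B.measurable.comp (measurable_torusLift _)
  unfold QuasiLocalGaugePerturbation.connectedCorr
  rw [expectation_mix b β β₁ _ (integrable_lift hρ β₁ hmAB hbAB) (integrable_lift hρ 0 hmAB hbAB),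
    expectation_mix b β β₁ _ (integrable_lift hρ β₁ hmA (fun U => hCA _))
      (integrable_lift hρ 0 hmA (fun U => hCA _)),
    expectation_mix b β β₁ _ (integrable_lift hρ β₁ hmB' (fun U => hCB _))
      (integrable_lift hρ 0 hmB' (fun U => hCB _))]
  simp only [smul_eq_mul]

end RP

/-! ## §3 `G = SU(3)`, fundamental representation: the plaquette species and its means -/

section SU3

/-- The gauge group `SU(3)` of the crux. [folklore] -/
abbrev SU3 : Type := ↥(Matrix.specialUnitaryGroup (Fin 3) ℂ)

/-- The fundamental representation of `SU(3)` (the crux's `ρ`). [folklore] -/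
abbrev ρ₃ : SU3 →* Matrix (Fin 3) (Fin 3) ℂ := fundamentalRep (Fin 3)

/-- The fundamental representation is continuous. [folklore] -/
theorem continuous_ρ₃ : Continuous ρ₃ := continuous_fundamentalRep _

/-- The plaquette species in the `(0,1)` plane at the origin (`Re tr U_p`, tree
`plaquetteObservable`). [folklore] -/
def P01 : YMSpecies SU3 := plaquetteObservable (d := 4) ρ₃ continuous_ρ₃ 0 1

/-- The underlying function of `P01`. [folklore] -/
theorem P01_F (V : LGConfig 4 SU3) : P01.F V = (ρ₃ (plaquetteHolonomyZd V 0 0 1)).trace.re := rfl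

/-- The support of `P01`: the four links of the plaquette. [folklore] -/
theorem P01_supp : P01.supp = originPlaquetteSupport (d := 4) 0 1 := rfl

/-- On periodic lifts the species reads the torus plaquette at the origin. [folklore] -/
theorem P01_torusLift {Lt : ℕ} [NeZero Lt] (U : GaugeConfig 4 Lt SU3) :
    P01.F (torusLift Lt U) = (ρ₃ (plaquetteHolonomy U 0 0 1)).trace.re := by
  rw [P01_F]
  have h : plaquetteHolonomyZd (torusLift Lt U) 0 0 1 = plaquetteHolonomy U 0 0 1 := by
    have h0 : Literature.Probability.LatticeModels.Torus.proj Lt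
        (0 : Literature.Probability.LatticeModels.Site 4) = (0 : Site 4 Lt) := by
      funext k; simp [Literature.Probability.LatticeModels.Torus.proj]
    rw [← h0]
    exact plaquette_torusLift Lt U 0 0 1
  rw [h]

/-- ... equivalently `3 ×` the normalised `1 × 1` Wilson loop. [folklore] -/
theorem P01_torusLift_eq_wilsonLoop {Lt : ℕ} [NeZero Lt] (U : GaugeConfig 4 Lt SU3) :
    P01.F (torusLift Lt U) = 3 * wilsonLoop ρ₃ (0 : Site 4 Lt) 0 1 1 1 U := by
  rw [P01_torusLift, wilsonLoop, rectangleHolonomy_one_one]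
  ring

/-- The links of `P01` have time coordinate in `[-1, 1]`. [folklore] -/
theorem P01_supp_time : ∀ e ∈ P01.supp, |e.1 0| ≤ ((1 : ℕ) : ℤ) := by
  intro e he
  rw [P01_supp, originPlaquetteSupport] at he
  simp only [Finset.mem_insert, Finset.mem_singleton] at he
  rcases he with rfl | rfl | rfl | rfl <;> simp

/-- The links of `P01` are based in the cube `{-1,0,1}^4`. [folklore] -/
theorem P01_supp_box : ∀ e ∈ P01.supp, e.1 ∈ Literature.Probability.LatticeModels.box 4 1 := by
  intro e he
  rw [P01_supp, originPlaquetteSupport] at he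
  simp only [Finset.mem_insert, Finset.mem_singleton] at he
  rw [Literature.Probability.LatticeModels.mem_box]
  intro i
  rcases he with rfl | rfl | rfl | rfl
  · simp
  · by_cases hi : i = 0
    · subst hi; simp
    · simp [hi]
  · by_cases hi : i = 1
    · subst hi; simp
    · simp [hi]
  · simp

/-- At `β = 0` the plaquette has mean zero (centre twist, tree `integral_reTr_eq_zero`). [folklore] -/
theorem integral_P01_zero {S : ℕ} (hS : 1 ≤ S) :
    ∫ U, P01.F (torusLift (2 * S + 1) U) ∂(wilsonMeasure (d := 4) (L := 2 * S + 1) ρ₃ 0) = 0 := by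
  rw [wilsonMeasure_zero_eq_pi]
  have hinj : Set.InjOn (torusEdge (d := 4) (2 * S + 1)) ↑P01.supp :=
    torusEdge_injOn (n := 1) (L := 2 * S) (by omega) fun e he => P01_supp_box e he
  have hdep : DependsOn P01.F (↑P01.supp : Set (Literature.MathematicalPhysics.QuantumLattice.ZdEdge 4)) :=
    P01.isCylinder
  rw [integral_torusLift_eq_integral_zdHaar hinj P01.measurable hdep]
  have : (fun U : ZdGaugeConfig 4 SU3 => P01.F U) =
      fun U => PlaquetteLowerBound.reTr ρ₃ (ZdGaugeConfig.plaquette U 0 0 1) := rfl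
  rw [this, PlaquetteLowerBound.integral_comp_plaquette_eq (PlaquetteLowerBound.continuous_reTr ρ₃
    continuous_ρ₃) 0 (by decide)]
  exact PlaquetteLowerBound.integral_reTr_eq_zero ρ₃ (TorusAreaLaw.isSpecialUnitaryModel_fundamentalRep 3) (by norm_num)

/-- **Strong-coupling lower bound, uniform in the volume** (tree `wilsonExpectation_plaquette_ge`,
first order of the cluster expansion): there are `β₁ > 0` and `m₀ > 0` with
`⟨Re tr U_p⟩_{2S+1, β₁} ≥ m₀` for all `S ≥ 1`. [folklore] -/
theorem exists_plaquette_mean_lower_bound :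
    ∃ β₁ : ℝ, 0 < β₁ ∧ ∃ m₀ : ℝ, 0 < m₀ ∧ ∀ S : ℕ, 1 ≤ S →
      m₀ ≤ ∫ U, P01.F (torusLift (2 * S + 1) U) ∂(wilsonMeasure (d := 4) (L := 2 * S + 1) ρ₃ β₁) := by
  have hSU := TorusAreaLaw.isSpecialUnitaryModel_fundamentalRep 3
  have hb1 : 0 < betaOne 4 ρ₃ := betaOne_pos 4 (ρ := ρ₃)
  have hV : 0 < PlaquetteLowerBound.charVariance ρ₃ :=
    PlaquetteLowerBound.charVariance_pos ρ₃ continuous_ρ₃ (by norm_num)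
  obtain ⟨Kc, hKc⟩ : ∃ Kc : ℝ, Kc = (2 * Real.exp (1 / 2)) ^ (4 * (2 ^ 4 * (4 * 4))) := ⟨_, rfl⟩
  have hKc0 : 0 < Kc := by rw [hKc]; positivity
  obtain ⟨A, hA⟩ : ∃ A : ℝ, A = (3 : ℝ)⁻¹ * PlaquetteLowerBound.charVariance ρ₃ * Real.exp (-1) :=
    ⟨_, rfl⟩
  have hA0 : 0 < A := by rw [hA]; positivity
  obtain ⟨B, hB⟩ : ∃ B : ℝ, B = A * betaOne 4 ρ₃ ^ 2 / (2 * Kc) := ⟨_, rfl⟩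
  have hB0 : 0 < B := by rw [hB]; positivity
  set β : ℝ := min (betaOne 4 ρ₃) (min (1 / (2 * 3)) B) with hβdef
  have hβ0 : 0 < β := lt_min hb1 (lt_min (by norm_num) hB0)
  have hβ1 : β ≤ betaOne 4 ρ₃ := min_le_left _ _
  have hβN : β ≤ 1 / (2 * 3) := (min_le_right _ _).trans (min_le_left _ _)
  have hβB : β ≤ B := (min_le_right _ _).trans (min_le_right _ _)
  refine ⟨β, hβ0, 3 * (A / 2 * β), by positivity, fun S hS => ?_⟩
  have key := PlaquetteLowerBound.wilsonExpectation_plaquette_ge ρ₃ hSU (by norm_num)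
    (show (0 : Fin 4) ≠ 1 by decide) (L := 2 * S) (by omega) hβ0.le hβ1
  have hint : ∫ U, P01.F (torusLift (2 * S + 1) U) ∂(wilsonMeasure (d := 4) (L := 2 * S + 1) ρ₃ β) =
      3 * wilsonExpectation (d := 4) (L := 2 * S + 1) ρ₃ β (wilsonLoop ρ₃ (0 : Site 4 (2 * S + 1)) 0 1 1 1) := by
    unfold wilsonExpectation
    rw [← integral_const_mul]
    refine integral_congr_ae (Eventually.of_forall fun U => ?_)
    exact P01_torusLift_eq_wilsonLoop U
  rw [hint]
  refine mul_le_mul_of_nonneg_left (le_trans ?_ key) (by norm_num)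
  rw [← hKc]
  have h1 : Real.exp (-1) ≤ Real.exp (-(2 * β * (3 : ℕ))) := by
    refine Real.exp_le_exp.2 ?_
    have : β * (2 * 3) ≤ 1 := by rwa [le_div_iff₀ (by positivity)] at hβN
    push_cast
    linarith
  have h2 : Kc * (β / betaOne 4 ρ₃) ^ 2 ≤ A / 2 * β := by
    have e : Kc * (β / betaOne 4 ρ₃) ^ 2 = Kc / betaOne 4 ρ₃ ^ 2 * β * β := by
      field_simp
    rw [e]
    refine mul_le_mul_of_nonneg_right ?_ hβ0.le
    calc Kc / betaOne 4 ρ₃ ^ 2 * β ≤ Kc / betaOne 4 ρ₃ ^ 2 * B :=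
          mul_le_mul_of_nonneg_left hβB (by positivity)
      _ = A / 2 := by rw [hB]; field_simp
  have h3 : A * β ≤ ((3 : ℕ) : ℝ)⁻¹ * (β * Real.exp (-(2 * β * (3 : ℕ))) *
      PlaquetteLowerBound.charVariance ρ₃) := by
    have e : ((3 : ℕ) : ℝ)⁻¹ * (β * Real.exp (-(2 * β * (3 : ℕ))) * PlaquetteLowerBound.charVariance ρ₃) =
        (3 : ℝ)⁻¹ * PlaquetteLowerBound.charVariance ρ₃ * Real.exp (-(2 * β * (3 : ℕ))) * β := by
      push_cast; ring
    rw [e, hA]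
    refine mul_le_mul_of_nonneg_right ?_ hβ0.le
    exact mul_le_mul_of_nonneg_left h1 (by positivity)
  linarith

end SU3

/-! ## §4 LOAD-BEARING: the crux with the smallness clause (h3) deleted is FALSE -/

section NoSmall

/-- **The body of `RobustYangMills` at decay rate `κ` with hypothesis (h3)
`‖W_{k,S}‖_{b_k,κ} ≤ η` deleted** (and with it the now idle `η₀`, `η`; `κ` survives only in the
Lipschitz clause (iv)): verbatim the crux `NestedDissectionSea.RobustYangMills`
(= `HeavyThresholdYMBridge.RobustYangMills` = `AdaptiveBlockFermions.RobustYangMills`,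
item `stmt-QuantumFields-13897`; the crux is `∃ η₀ > 0, ∃ κ ≥ 0, body`) except that the
admissibility predicate keeps only (h1) lattice symmetry of the total, (h2) reflection
positivity, (h4) range control. -/
def RobustYangMillsNoSmall (κ : ℝ) : Prop :=
  let G := ↥(Matrix.specialUnitaryGroup (Fin 3) ℂ); let ρ : G →* Matrix (Fin 3) (Fin 3) ℂ := fundamentalRep (Fin 3); let r₃ : LatticeRep G := ⟨3, ρ, continuous_fundamentalRep _, fundamentalRep_injective _, fundamentalRep_mem_unitaryGroup⟩; ∀ (a : ℕ → ℝ) (L : ℕ → ℕ) (ha : ∀ k, 0 < a k) (ha₀ : Filter.Tendsto a Filter.atTop (nhds 0)) (haL : Filter.Tendsto (fun k => a k * L k) Filter.atTop Filter.atTop) (β' : ℕ → ℝ) (Λ' : ℝ), 0 < Λ' → Filter.Tendsto (fun k => β' k - afBeta 0 Λ' (a k)) Filter.atTop (nhds 0) → ∀ ℓ₀ : ℝ, 0 < ℓ₀ → let AdmAt : ((k : ℕ) → (S : ℕ) → QuasiLocalGaugePerturbation 4 (2 * S + 1) G ⌊ℓ₀ / a k⌋₊) → ℕ → Prop := fun W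 k => ∀ S : ℕ, L k ≤ S → (∀ (v : Site 4 (2 * S + 1)) (U : GaugeConfig 4 (2 * S + 1) G), (W k S).total (torusConfigShift v U) = (W k S).total U) ∧ (∀ U : GaugeConfig 4 (2 * S + 1) G, (W k S).total (GaugeConfig.timeReflect U) = (W k S).total U) ∧ (∀ (π : Equiv.Perm (Fin 4)) (U : GaugeConfig 4 (2 * S + 1) G), (W k S).total (fun e => U (e.1 ∘ π, π.symm e.2)) = (W k S).total U) ∧ (W k S).IsReflectionPositive ρ (β' k) ∧ (∀ X : Finset (Site 4 (2 * S + 1)), X ∈ polymers ⌊ℓ₀ / a k⌋₊ → (∃ U : GaugeConfig 4 (2 * S + 1) G, (W k S).act X U ≠ 0) → ∀ y ∈ X, ∀ y' ∈ X, ∀ i : Fin 4, (y i - y' i).val ≤ ⌊ℓ₀ / a k⌋₊ * X.card ∨ (y' i - y i).val ≤ ⌊ℓ₀ / a k⌋₊ * X.card); ∀ W, (∀ᶠ k in Filter.atTop, AdmAt W k) → ∃ φ : ℕ → ℕ, StrictMono φ ∧ ∃ (c m : YMSpecies G → ℕ → ℝ) (T : OSData (YMSpecies G) 4) (Δ : ℝ),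 0 < Δ ∧ (∀ n : ℕ, n ≠ 0 → ∀ (σ : Fin n → YMSpecies G) (f : Fin n → SchwartzMap (EuclideanSpace ℝ (Fin 4)) ℝ) (F : SchwartzMap (Fin n → EuclideanSpace ℝ (Fin 4)) ℂ), IsTensorOf F (fun i => ofRealTest (f i)) → IsOffDiagonal F → Filter.Tendsto (fun j : ℕ => ((perturbedLatticeSchwinger ρ (⟨a, ha, ha₀, β', L, haL, c, m⟩ : SpeciesScheme (YMSpecies G)) (fun k => W k (L k)) (fun s => s.F) (φ j) n σ f : ℝ) : ℂ)) Filter.atTop (nhds (T.schwinger n σ F))) ∧ T.IsNontrivial r₃.curvature ∧ T.IsNonGaussian r₃.curvature ∧ T.HasMassGap Δ ∧ (∀ A B : YMSpecies G, ∃ C : ℝ, ∀ᶠ k in Filter.atTop, ∀ S : ℕ, L k ≤ S → ∀ n : ℕ, n ≤ S → |(W k S).connectedCorr ρ (β' k) A.F B.F n| ≤ C * Real.exp (-(Δ * (a k * n)))) ∧ (∀ (n : ℕ) (σ : Fin n → YMSpecies G) (f : Fin n → SchwartzMap (EuclideanSpace ℝ (Fin 4)) ℝ), ∃ C : ℝ,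 ∀ᶠ k in Filter.atTop, ∀ W', AdmAt W' k → ∀ δ : ℝ, 0 ≤ δ → (∀ S : ℕ, L k ≤ S → (W k S - W' k S).NormLE κ δ) → |perturbedLatticeSchwinger ρ (⟨a, ha, ha₀, β', L, haL, c, m⟩ : SpeciesScheme (YMSpecies G)) (fun k => W k (L k)) (fun s => s.F) k n σ f - perturbedLatticeSchwinger ρ (⟨a, ha, ha₀, β', L, haL, c, m⟩ : SpeciesScheme (YMSpecies G)) (fun k => W' k (L k)) (fun s => s.F) k n σ f| ≤ C * δ)

/-- **Any proof of `RobustYangMills` must use the smallness clause (h3)**: the crux with (h3)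
deleted is false. Witnesses, for every `k` and every odd torus `2S+1`: the ONE-activity
perturbations carried by the polymer of ALL block corners (legal in D1's class; (h4) holds because
`2S+1 ≤ b_k · #corners`), with activity
`W¹(U) = (β₁ - β'_k) S_W(U)` (so `μ_{β'_k, W¹} = μ_{β₁}`, the Wilson theory at a FIXED small
coupling `β₁ > 0`) and `W^{mix}(U) = -β'_k S_W(U) - log(e^{-β₁ S_W(U)} + Z_{β₁})` (so
`μ_{β'_k, W^{mix}} = ½ μ_{β₁} + ½ μ_0`, `μ_0` = product Haar). Both are invariant under all lattice
symmetries ((h1): `S_W` is) and reflection positive ((h2): odd-torus Osterwalder–Seiler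
positivity of `μ_{β₁}` and `μ_0`, tree `wilsonExpectation_oddReflectionPositive`). For the
plaquette species `P` the mixture has LONG-RANGE ORDER:
`⟨P; τ_n P⟩_{mix} = ½ ⟨P; τ_n P⟩_{β₁} + ¼ ⟨P⟩_{β₁}²` (`⟨P⟩_0 = 0` by the centre twist,
independence of link-disjoint plaquettes under Haar), while the uniform lattice-gap clause
(iii') for `W¹` forces `⟨P; τ_S P⟩_{β₁, 2S+1} → 0` and for `W^{mix}` forces
`⟨P; τ_S P⟩_{mix} → 0` as `S → ∞` at fixed `k`; but `⟨P⟩_{β₁, 2S+1} ≥ m₀ > 0` uniformly in `S`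
(first-order strong-coupling expansion, tree `wilsonExpectation_plaquette_ge`). Contradiction.
So (h1), (h2), (h4) do not constrain global (mean-field / mixture) activities at all; the ENTIRE
locality and stability content of the admissible cone sits in the weighted sup-norm bound (h3). -/
theorem robustYangMillsNoSmall_false (κ : ℝ) : ¬ RobustYangMillsNoSmall κ := by
  intro h
  -- scaling data: `a_k = 1/(k+1)`, `L_k = (k+1)²`, `Λ' = ℓ₀ = 1`, `β'_k = afBeta 0 1 a_k`
  have hzero := SpeciesScheme.zero (YMSpecies SU3)
  set a : ℕ → ℝ := fun k => ((k : ℝ) + 1)⁻¹ with ha_def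
  set L : ℕ → ℕ := fun k => (k + 1) ^ 2 with hL_def
  have ha : ∀ k, 0 < a k := fun k => by positivity
  have ha₀ : Tendsto a atTop (𝓝 0) :=
    tendsto_inv_atTop_zero.comp (tendsto_natCast_atTop_atTop.atTop_add tendsto_const_nhds)
  have haL : Tendsto (fun k => a k * L k) atTop atTop := by
    have e : (fun k : ℕ => a k * (L k : ℝ)) = fun k : ℕ => (k : ℝ) + 1 := by
      funext k; simp only [ha_def, hL_def]; push_cast; field_simp
    rw [e]
    exact tendsto_natCast_atTop_atTop.atTop_add tendsto_const_nhds
  set β' : ℕ → ℝ := fun k => afBeta 0 1 (a k) with hβ'_def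
  have hβ' : Tendsto (fun k => β' k - afBeta 0 1 (a k)) atTop (𝓝 0) := by
    simp only [hβ'_def, sub_self]; exact tendsto_const_nhds
  have h1 := h a L ha ha₀ haL β' 1 one_pos hβ' 1 one_pos
  -- block sizes
  have hb : ∀ k, 1 ≤ ⌊(1 : ℝ) / a k⌋₊ := fun k => by
    rw [Nat.le_floor_iff (by positivity)]
    simp only [ha_def, one_div, inv_inv, Nat.cast_one]
    linarith [(k.cast_nonneg : (0 : ℝ) ≤ k)]
  have hL1 : ∀ k S, L k ≤ S → 1 ≤ S := fun k S hS => by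
    have : 1 ≤ L k := Nat.one_le_pow _ _ (Nat.succ_pos k)
    omega
  -- the strong-coupling data
  obtain ⟨β₁, hβ₁, m₀, hm₀, hmean⟩ := exists_plaquette_mean_lower_bound
  -- the two witnesses are admissible (for ALL k)
  obtain ⟨φ₁, -, c₁, mm₁, T₁, Δ₁, hΔ₁, -, -, -, -, hgap₁, -⟩ := h1
    (fun k S => globalPert (Lt := 2 * S + 1) ρ₃ continuous_ρ₃ ⌊(1 : ℝ) / a k⌋₊ (gOne (β' k) β₁)
      (continuous_gOne (β' k) β₁))
    (Eventually.of_forall fun k S hS =>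
      ⟨fun v U => total_globalPert_shift _ _ _ v U,
       fun U => total_globalPert_timeReflect _ _ _ U,
       fun π U => total_globalPert_perm _ _ _ π U,
       isReflectionPositive_one continuous_ρ₃ (hL1 k S hS) _ _ hβ₁.le,
       fun X _ hne y hy y' hy' i => rangeControl_globalPert (hb k) _ _ X hne y hy y' hy' i⟩)
  obtain ⟨φ₂, -, c₂, mm₂, T₂, Δ₂, hΔ₂, -, -, -, -, hgap₂, -⟩ := h1
    (fun k S => globalPert (Lt := 2 * S + 1) ρ₃ continuous_ρ₃ ⌊(1 : ℝ) / a k⌋₊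
      (gMix (β' k) β₁ (partitionFunction (d := 4) (L := 2 * S + 1) ρ₃ β₁).toReal)
      (continuous_gMix (β' k) β₁ _ ENNReal.toReal_nonneg))
    (Eventually.of_forall fun k S hS =>
      ⟨fun v U => total_globalPert_shift _ _ _ v U,
       fun U => total_globalPert_timeReflect _ _ _ U,
       fun π U => total_globalPert_perm _ _ _ π U,
       isReflectionPositive_mix continuous_ρ₃ (hL1 k S hS) _ _ hβ₁.le,
       fun X _ hne y hy y' hy' i => rangeControl_globalPert (hb k) _ _ X hne y hy y' hy' i⟩)
  obtain ⟨C₁, hC₁⟩ := hgap₁ P01 P01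
  obtain ⟨C₂, hC₂⟩ := hgap₂ P01 P01
  obtain ⟨k, hk₁, hk₂⟩ := (hC₁.and hC₂).exists
  -- abbreviations for the Wilson integrals at step (β₁, S) and (0, S)
  have key : ∀ S : ℕ, L k ≤ S → 3 ≤ S →
      m₀ ^ 2 / 4 ≤ C₂ * Real.exp (-(Δ₂ * (a k * S))) + 2⁻¹ * (C₁ * Real.exp (-(Δ₁ * (a k * S)))) := by
    intro S hLS h3S
    have hS1 : 1 ≤ S := by omega
    have e1 := hk₁ S hLS S le_rfl
    have e2 := hk₂ S hLS S le_rfl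
    rw [connectedCorr_one] at e1
    rw [connectedCorr_mix continuous_ρ₃] at e2
    -- zero-coupling facts and translation invariance
    have hz : ∫ U, P01.F (torusLift (2 * S + 1) U) ∂(wilsonMeasure (d := 4) (L := 2 * S + 1) ρ₃ 0) = 0 :=
      integral_P01_zero hS1
    have hdisj := Summit.QuantumFields.YangMills.Theorems.LatticeGapOnTrajectory.Negative.disjoint_torusSupports_of_time_bound
      P01.supp P01.supp 1 P01_supp_time P01_supp_time (S := 2 * S + 1) (n := S) (by omega) (by omega)
    have hcc0 := Summit.QuantumFields.YangMills.Theorems.LatticeGapOnTrajectory.Negative.latticeConnectedCorr_zero_coupling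
      ρ₃ (2 * S + 1) P01 P01 S hdisj
    unfold latticeConnectedCorr at e1 hcc0
    rw [hz, mul_zero, sub_eq_zero] at hcc0
    rw [hz, hcc0] at e2
    have hI := hmean S hS1
    set I := ∫ U, P01.F (torusLift (2 * S + 1) U) ∂(wilsonMeasure (d := 4) (L := 2 * S + 1) ρ₃ β₁)
    set J := ∫ U, P01.F (torusLift (2 * S + 1) U) *
        P01.F (configShift (-Pi.single 0 (S : ℤ)) (torusLift (2 * S + 1) U))
          ∂(wilsonMeasure (d := 4) (L := 2 * S + 1) ρ₃ β₁)
    have hsq : m₀ ^ 2 ≤ I ^ 2 := pow_le_pow_left₀ hm₀.le hI 2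
    have f1 := (abs_le.1 e1).1
    have f2 := (abs_le.1 e2).2
    nlinarith [f1, f2, hsq]
  -- the right-hand side tends to `0` as `S → ∞` (fixed `k`)
  have hlim : Tendsto (fun S : ℕ => C₂ * Real.exp (-(Δ₂ * (a k * S))) +
      2⁻¹ * (C₁ * Real.exp (-(Δ₁ * (a k * S))))) atTop (𝓝 0) := by
    have hx : ∀ Δ : ℝ, 0 < Δ → Tendsto (fun S : ℕ => Real.exp (-(Δ * (a k * S)))) atTop (𝓝 0) := by
      intro Δ hΔ
      refine Real.tendsto_exp_atBot.comp ?_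
      refine tendsto_neg_atTop_atBot.comp ?_
      exact Tendsto.const_mul_atTop hΔ (Tendsto.const_mul_atTop (ha k) tendsto_natCast_atTop_atTop)
    have := ((hx Δ₂ hΔ₂).const_mul C₂).add (((hx Δ₁ hΔ₁).const_mul C₁).const_mul 2⁻¹)
    simpa using this
  have hle : m₀ ^ 2 / 4 ≤ 0 :=
    ge_of_tendsto hlim (Filter.eventually_atTop.2 ⟨max (L k) 3, fun S hS =>
      key S (le_of_max_le_left hS) (le_of_max_le_right hS)⟩)
  nlinarith [hm₀]

end NoSmall

/-! ## §5 `W ≡ 0` is admissible: the crux contains the Clay-type statement for the Wilson action -/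

section ZeroAdmissible

/-- The pure-gauge two-loop profile diverges along every scaling sequence:
`afBeta 0 Λ a_k → +∞` as `a_k → 0⁺` (`Λ > 0`; `b₀, b₁ > 0` at `N_f = 0`). [folklore] -/
theorem tendsto_afBeta_zero_atTop {a : ℕ → ℝ} (ha : ∀ k, 0 < a k)
    (ha₀ : Filter.Tendsto a Filter.atTop (nhds 0)) {Λ : ℝ} (hΛ : 0 < Λ) :
    Filter.Tendsto (fun k => afBeta 0 Λ (a k)) Filter.atTop Filter.atTop := by
  have hu : Tendsto (fun k => 1 / (a k ^ 2 * Λ ^ 2)) atTop atTop := by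
    simp only [one_div]
    refine tendsto_inv_nhdsGT_zero.comp ?_
    refine tendsto_nhdsWithin_iff.2 ⟨?_, Eventually.of_forall fun k => ?_⟩
    · simpa using (ha₀.pow 2).mul_const (Λ ^ 2)
    · exact Set.mem_Ioi.2 (by have := ha k; positivity)
  have hlog := Real.tendsto_log_atTop.comp hu
  have hb0 : 0 < betaCoeff₀ 0 := by unfold betaCoeff₀; norm_num; positivity
  have hb1 : 0 < betaCoeff₁ 0 := by unfold betaCoeff₁; norm_num; positivity
  have hmain : Tendsto (fun k => 2 * betaCoeff₀ 0 * Real.log (1 / (a k ^ 2 * Λ ^ 2))) atTop atTop :=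
    Tendsto.const_mul_atTop (by positivity) hlog
  refine tendsto_atTop_mono' atTop ?_ hmain
  filter_upwards [hlog.eventually_ge_atTop 1] with k hk
  unfold afBeta
  have hll : 0 ≤ Real.log (Real.log (1 / (a k ^ 2 * Λ ^ 2))) := Real.log_nonneg hk
  have : 0 ≤ 2 * (betaCoeff₁ 0 / betaCoeff₀ 0) * Real.log (Real.log (1 / (a k ^ 2 * Λ ^ 2))) := by
    positivity
  linarith

/-- Hence every coupling sequence `β'` with `β'_k - afBeta 0 Λ a_k → 0` is eventually `≥ 0`. [folklore] -/
theorem eventually_nonneg_of_af {a : ℕ → ℝ} (ha : ∀ k, 0 < a k)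
    (ha₀ : Filter.Tendsto a Filter.atTop (nhds 0)) {β' : ℕ → ℝ} {Λ : ℝ} (hΛ : 0 < Λ)
    (hβ' : Filter.Tendsto (fun k => β' k - afBeta 0 Λ (a k)) Filter.atTop (nhds 0)) :
    ∀ᶠ k in Filter.atTop, 0 ≤ β' k := by
  have h : Tendsto (fun k => (β' k - afBeta 0 Λ (a k)) + afBeta 0 Λ (a k)) atTop atTop :=
    hβ'.add_atTop (tendsto_afBeta_zero_atTop ha ha₀ hΛ)
  simp only [sub_add_cancel] at h
  exact h.eventually_ge_atTop 0

/-- **What the crux says about the UNPERTURBED theory** (`W ≡ 0`) along the scaling data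
`(a, L)` and the coupling sequence `β'`: the `SU(3)` Wilson lattice theory has a subsequential continuum limit `T` (joint Schwinger functions
of all gauge-invariant species on `⁰𝒮`) with non-trivial non-Gaussian curvature, a mass gap
`Δ > 0` of the full Hamiltonian, and the uniform lattice gap `HasLatticeMassGap` at the same
`Δ` — Clay's Yang–Mills problem for `SU(3)` in the tree's rendering, plus `β`-universality. -/
def WilsonConsequences (a : ℕ → ℝ) (L : ℕ → ℕ) (ha : ∀ k, 0 < a k)
    (ha₀ : Filter.Tendsto a Filter.atTop (nhds 0))
    (haL : Filter.Tendsto (fun k => a k * L k) Filter.atTop Filter.atTop) (β' : ℕ → ℝ) : Prop :=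
  let G := ↥(Matrix.specialUnitaryGroup (Fin 3) ℂ); let ρ : G →* Matrix (Fin 3) (Fin 3) ℂ := fundamentalRep (Fin 3); let r₃ : LatticeRep G := ⟨3, ρ, continuous_fundamentalRep _, fundamentalRep_injective _, fundamentalRep_mem_unitaryGroup⟩;
    ∃ φ : ℕ → ℕ, StrictMono φ ∧ ∃ (c m : YMSpecies G → ℕ → ℝ) (T : OSData (YMSpecies G) 4) (Δ : ℝ),
      0 < Δ ∧
      (∀ n : ℕ, n ≠ 0 → ∀ (σ : Fin n → YMSpecies G) (f : Fin n → SchwartzMap (EuclideanSpace ℝ (Fin 4)) ℝ)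
        (F : SchwartzMap (Fin n → EuclideanSpace ℝ (Fin 4)) ℂ),
        IsTensorOf F (fun i => ofRealTest (f i)) → IsOffDiagonal F →
          Filter.Tendsto (fun j : ℕ => ((latticeSchwinger ρ
            (⟨a, ha, ha₀, β', L, haL, c, m⟩ : SpeciesScheme (YMSpecies G)) (fun s => s.F) (φ j) n σ f : ℝ) : ℂ))
            Filter.atTop (nhds (T.schwinger n σ F))) ∧
      T.IsNontrivial r₃.curvature ∧ T.IsNonGaussian r₃.curvature ∧ T.HasMassGap Δ ∧
      HasLatticeMassGap r₃ (⟨a, ha, ha₀, β', L, haL, c, m⟩ : SpeciesScheme (YMSpecies G)) Δ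

/-- **The crux implies the Clay-type statement for the unperturbed Wilson action**: `W ≡ 0` is
admissible — (h1) trivially, (h2) by odd-torus reflection positivity of the Wilson measure
(tree, PROVED: `wilsonExpectation_oddReflectionPositive`), (h3) `‖0‖ = 0 ≤ η`, (h4) vacuously —
so the conclusion applies to it; D1's `perturbedLatticeSchwinger_zero` / `connectedCorr_zero`
identify the perturbed objects with the tree's `latticeSchwinger` / `latticeConnectedCorr`.
Hence the crux is at least as strong as `SU(3)` Yang–Mills existence with OS axioms,
non-triviality and mass gap along (a subsequence of) EVERY a.f. Wilson scaling sequence; any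
disproof of it through `W ≡ 0` would disprove that. [folklore] -/
theorem robustYangMills_imp_wilson
    (hR : Summit.QuantumFields.QCD.Theses.NestedDissectionSea.RobustYangMills)
    (a : ℕ → ℝ) (L : ℕ → ℕ) (ha : ∀ k, 0 < a k) (ha₀ : Filter.Tendsto a Filter.atTop (nhds 0))
    (haL : Filter.Tendsto (fun k => a k * L k) Filter.atTop Filter.atTop) (β' : ℕ → ℝ) (Λ' : ℝ)
    (hΛ' : 0 < Λ') (hβ' : Filter.Tendsto (fun k => β' k - afBeta 0 Λ' (a k)) Filter.atTop (nhds 0)) :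
    WilsonConsequences a L ha ha₀ haL β' := by
  have hpos : ∀ᶠ k in Filter.atTop, 0 ≤ β' k := eventually_nonneg_of_af ha ha₀ hΛ' hβ'
  obtain ⟨η₀, hη₀, κ, -, h⟩ := hR
  have h1 := h a L ha ha₀ haL β' Λ' hΛ' hβ' 1 one_pos
  have hη : 0 ≤ η₀ / max 1 (afBeta 0 Λ' 1) := div_nonneg hη₀.le (le_trans zero_le_one (le_max_left _ _))
  have hL1 : ∀ᶠ k in atTop, 1 ≤ L k := by
    have h2 : ∀ᶠ k in atTop, (1 : ℝ) ≤ a k * L k := haL.eventually_ge_atTop 1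
    have h3 : ∀ᶠ k in atTop, a k ≤ 1 := (ha₀.eventually (gt_mem_nhds one_pos)).mono fun k hk => hk.le
    filter_upwards [h2, h3] with k hk hk'
    by_contra hcon
    push Not at hcon
    have : L k = 0 := by omega
    rw [this] at hk
    simp at hk
    linarith
  obtain ⟨φ, hφ, c, m, T, Δ, hΔ, hconv, hnt, hng, hgapT, hgapL, -⟩ := h1 (fun k S => 0) (by
    filter_upwards [hpos, hL1] with k hk hkL S hS
    refine ⟨fun v U => by simp, fun U => by simp, fun π U => by simp,
      isReflectionPositive_zero_odd (fundamentalRep (Fin 3)) (le_trans hkL hS) (continuous_fundamentalRep _) hk _,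
      QuasiLocalGaugePerturbation.normLE_zero hη, ?_⟩
    rintro X - ⟨U, hU⟩
    simp at hU)
  refine ⟨φ, hφ, c, m, T, Δ, hΔ, fun n hn σ f F hF hF' => ?_, hnt, hng, hgapT, fun A B => ?_⟩
  · have := hconv n hn σ f F hF hF'
    refine this.congr fun j => ?_
    exact congrArg (fun r : ℝ => (r : ℂ))
      (perturbedLatticeSchwinger_zero (fundamentalRep (Fin 3))
        (⟨a, ha, ha₀, β', L, haL, c, m⟩ : SpeciesScheme (YMSpecies SU3))
        (bs := fun k => ⌊(1 : ℝ) / a k⌋₊) (fun s => s.F) (φ j) n σ f)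
  · obtain ⟨C, hC⟩ := hgapL A B
    refine ⟨C, ?_⟩
    filter_upwards [hC] with k hk S hS n hn
    have := hk S hS n hn
    beta_reduce at this
    rwa [QuasiLocalGaugePerturbation.connectedCorr_zero] at this

end ZeroAdmissible

/-! ## §6 (gen 2) The coupling shift is admissible; the β-direction reading of clause (iv)

### §6a Range control (h4) of the plaquette support polymers -/

section Corners

variable {d L : ℕ} [NeZero L] {b : ℕ}

/-- One lattice step moves the block corner coordinate by at most `b`, one way round the torus:
`val (⌊(v+1)/b⌋ b − ⌊v/b⌋ b) ≤ b` in `ℤ/L` (also across the seam `v = L - 1`). [folklore] -/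
theorem corner_succ_sub_val_le (hb : 0 < b) (v : ZMod L) :
    ((((v + 1).val / b * b : ℕ) : ZMod L) - ((v.val / b * b : ℕ) : ZMod L)).val ≤ b := by
  have hL : 0 < L := Nat.pos_of_ne_zero (NeZero.ne L)
  have hmL : v.val < L := ZMod.val_lt v
  have hv1 : (v + 1).val = (v.val + 1) % L := by
    have : v + 1 = ((v.val + 1 : ℕ) : ZMod L) := by
      rw [Nat.cast_add, Nat.cast_one, ZMod.natCast_zmod_val]
    rw [this, ZMod.val_natCast]
  -- abstract the two corner coordinates as naturals `q ≤ q'`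
  obtain ⟨q, hq_eq, hq1, hq2⟩ : ∃ q : ℕ, v.val / b * b = q ∧ q ≤ v.val ∧ v.val < q + b :=
    ⟨_, rfl, Nat.div_mul_le_self _ _, Nat.lt_div_mul_add hb⟩
  have hmono : v.val / b * b ≤ (v.val + 1) / b * b :=
    Nat.mul_le_mul_right _ (Nat.div_le_div_right (Nat.le_succ _))
  obtain ⟨q', hq'_eq, hq'1, hq'2⟩ : ∃ q' : ℕ, (v.val + 1) / b * b = q' ∧ q' ≤ v.val + 1 ∧ q ≤ q' :=
    ⟨_, rfl, Nat.div_mul_le_self _ _, by rw [← hq_eq]; exact hmono⟩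
  rcases Nat.lt_or_ge (v.val + 1) L with h | h
  · rw [hv1, Nat.mod_eq_of_lt h, hq'_eq, hq_eq, ← Nat.cast_sub hq'2, ZMod.val_natCast]
    exact (Nat.mod_le _ _).trans (by omega)
  · have hmL' : v.val + 1 = L := le_antisymm hmL h
    rw [hv1, hmL', Nat.mod_self, Nat.zero_div, zero_mul, Nat.cast_zero, zero_sub, ZMod.neg_val',
      hq_eq, ZMod.val_natCast, Nat.mod_eq_of_lt (by omega : q < L)]
    exact (Nat.mod_le _ _).trans (by omega)

omit [NeZero L] in
/-- Away from the shifted coordinate the block corner does not move. [folklore] -/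
theorem blockCorner_shift_apply_of_ne (x : Site d L) {j i : Fin d} (hij : i ≠ j) :
    blockCorner b (x.shift j) i = blockCorner b x i := by
  have : (x.shift j) i = x i := by simp [Site.shift, hij]
  simp only [blockCorner, this]

/-- The block corners of `x + eⱼ` and `x` differ coordinatewise by at most `b` (one-sided). [folklore] -/
theorem blockCorner_shift_sub_val_le (hb : 0 < b) (x : Site d L) (j i : Fin d) :
    (blockCorner b (x.shift j) i - blockCorner b x i).val ≤ b := by
  by_cases hij : i = j
  · subst hij
    have : (x.shift i) i = x i + 1 := by simp [Site.shift]
    simp only [blockCorner, this]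
    exact corner_succ_sub_val_le hb (x i)
  · rw [blockCorner_shift_apply_of_ne x hij, sub_self, ZMod.val_zero]
    exact Nat.zero_le _

/-- The block corners of `x + eⱼ` and `x + eₗ` differ coordinatewise by at most `b`, one way or the
other. [folklore] -/
theorem blockCorner_shift_pair (hb : 0 < b) (x : Site d L) (j l i : Fin d) :
    (blockCorner b (x.shift j) i - blockCorner b (x.shift l) i).val ≤ b ∨
      (blockCorner b (x.shift l) i - blockCorner b (x.shift j) i).val ≤ b := by
  by_cases hij : i = j
  · by_cases hil : i = l
    · left
      rw [← hij, ← hil, sub_self, ZMod.val_zero]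
      exact Nat.zero_le _
    · left
      rw [blockCorner_shift_apply_of_ne x hil]
      exact blockCorner_shift_sub_val_le hb x j i
  · right
    rw [blockCorner_shift_apply_of_ne x hij]
    exact blockCorner_shift_sub_val_le hb x l i

/-- **(h4) for plaquette supports**: any two of the (at most three) corners of `plaquetteSupport b p`
differ in every coordinate by at most `b`, one way round the torus or the other. [folklore] -/
theorem rangeControl_plaquetteSupport (hb : 0 < b) (p : Plaquette d L) (y : Site d L)
    (hy : y ∈ plaquetteSupport b p) (y' : Site d L) (hy' : y' ∈ plaquetteSupport b p) (i : Fin d) :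
    (y i - y' i).val ≤ b ∨ (y' i - y i).val ≤ b := by
  have h0 : ∀ z : Site d L, (z i - z i).val ≤ b ∨ (z i - z i).val ≤ b := fun z =>
    Or.inl (by rw [sub_self, ZMod.val_zero]; exact Nat.zero_le _)
  simp only [plaquetteSupport, Finset.mem_insert, Finset.mem_singleton] at hy hy'
  rcases hy with rfl | rfl | rfl <;> rcases hy' with rfl | rfl | rfl
  · exact h0 (blockCorner b p.1)
  · exact Or.inr (blockCorner_shift_sub_val_le hb p.1 p.2.1.1 i)
  · exact Or.inr (blockCorner_shift_sub_val_le hb p.1 p.2.1.2 i)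
  · exact Or.inl (blockCorner_shift_sub_val_le hb p.1 p.2.1.1 i)
  · exact h0 (blockCorner b (p.1.shift p.2.1.1))
  · exact blockCorner_shift_pair hb p.1 p.2.1.1 p.2.1.2 i
  · exact Or.inl (blockCorner_shift_sub_val_le hb p.1 p.2.1.2 i)
  · exact blockCorner_shift_pair hb p.1 p.2.1.2 p.2.1.1 i
  · exact h0 (blockCorner b (p.1.shift p.2.1.2))

end Corners

/-! ### §6b The coupling shift `t • wilson` passes (h1)–(h4) -/

section Shift

variable {G : Type} [Group G] [TopologicalSpace G] [IsTopologicalGroup G] [CompactSpace G]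
  [MeasurableSpace G] [BorelSpace G] [SecondCountableTopology G] {N : ℕ}
  (ρ : G →* Matrix (Fin N) (Fin N) ℂ) (hρ : Continuous ρ)

/-- **(h4) for the coupling shift**: the activities of `t • wilson` live on plaquette supports. [folklore] -/
theorem rangeControl_smul_wilson {d L : ℕ} [NeZero L] {b : ℕ} (hb : 0 < b) (t : ℝ)
    (X : Finset (Site d L))
    (hne : ∃ U : GaugeConfig d L G, (t • QuasiLocalGaugePerturbation.wilson ρ hρ b).act X U ≠ 0)
    (y : Site d L) (hy : y ∈ X) (y' : Site d L) (hy' : y' ∈ X) (i : Fin d) :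
    (y i - y' i).val ≤ b * X.card ∨ (y' i - y i).val ≤ b * X.card := by
  obtain ⟨U, hU⟩ := hne
  rw [QuasiLocalGaugePerturbation.smul_act, QuasiLocalGaugePerturbation.wilson_act] at hU
  have hX : ∃ p : Plaquette d L, plaquetteSupport b p = X := by
    by_contra h
    push Not at h
    apply hU
    rw [Finset.filter_false_of_mem (fun p _ => h p), Finset.sum_empty, mul_zero]
  obtain ⟨p, rfl⟩ := hX
  have hcard : 0 < (plaquetteSupport b p).card := Finset.card_pos.2 ⟨y, hy⟩
  have hbb : b ≤ b * (plaquetteSupport b p).card := Nat.le_mul_of_pos_right _ hcard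
  exact (rangeControl_plaquetteSupport hb p y hy y' hy' i).imp (fun h => h.trans hbb) fun h => h.trans hbb

variable {Lt : ℕ} [NeZero Lt]

/-- The total of `t • wilson` is `t · S_W`. [folklore] -/
theorem total_smul_wilson_apply (b : ℕ) (t : ℝ) (U : GaugeConfig 4 Lt G) :
    (t • QuasiLocalGaugePerturbation.wilson ρ hρ b).total U = t * wilsonAction ρ U := by
  rw [QuasiLocalGaugePerturbation.total_smul, QuasiLocalGaugePerturbation.total_wilson]
  rfl

/-- (h1a) for the coupling shift. [folklore] -/
theorem total_smul_wilson_shift (b : ℕ) (t : ℝ) (v : Site 4 Lt) (U : GaugeConfig 4 Lt G) :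
    (t • QuasiLocalGaugePerturbation.wilson ρ hρ b).total (torusConfigShift v U) =
      (t • QuasiLocalGaugePerturbation.wilson ρ hρ b).total U := by
  rw [total_smul_wilson_apply, total_smul_wilson_apply, wilsonAction_torusConfigShift]

/-- (h1b) for the coupling shift. [folklore] -/
theorem total_smul_wilson_timeReflect (b : ℕ) (t : ℝ) (U : GaugeConfig 4 Lt G) :
    (t • QuasiLocalGaugePerturbation.wilson ρ hρ b).total (GaugeConfig.timeReflect U) =
      (t • QuasiLocalGaugePerturbation.wilson ρ hρ b).total U := by
  rw [total_smul_wilson_apply, total_smul_wilson_apply, wilsonAction_timeReflect ρ hρ]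

/-- (h1c) for the coupling shift. [folklore] -/
theorem total_smul_wilson_perm (b : ℕ) (t : ℝ) (π : Equiv.Perm (Fin 4)) (U : GaugeConfig 4 Lt G) :
    (t • QuasiLocalGaugePerturbation.wilson ρ hρ b).total (fun e => U (e.1 ∘ π, π.symm e.2)) =
      (t • QuasiLocalGaugePerturbation.wilson ρ hρ b).total U := by
  rw [← configPerm_eq, total_smul_wilson_apply, total_smul_wilson_apply, wilsonAction_configPerm ρ hρ]

/-- **(h2) for the coupling shift**: `μ_{β, t • wilson} = μ_{β + t}` is reflection positive on the odd
torus `2S+1`, `S ≥ 1`, as soon as `β + t ≥ 0` (tree: Osterwalder–Seiler odd-torus positivity). [folklore] -/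
theorem isReflectionPositive_smul_wilson {S : ℕ} (hS : 1 ≤ S) (b : ℕ) {β t : ℝ} (hβt : 0 ≤ β + t) :
    (t • QuasiLocalGaugePerturbation.wilson (d := 4) (L := 2 * S + 1) ρ hρ b).IsReflectionPositive ρ β := by
  intro F hF hFb hFpos
  rw [QuasiLocalGaugePerturbation.expectation_smul_wilson]
  exact wilsonExpectation_oddRP ρ hS hρ hβt F hF hFb hFpos

end Shift

/-! ### §6c `G = SU(3)`: the crux read on the Wilson theory in the β-direction -/

section SU3Shift

/-- The fundamental representation of `SU(3)` is unitary. [folklore] -/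
theorem ρ₃_mem_unitary : ∀ g : SU3, ρ₃ g ∈ Matrix.unitaryGroup (Fin 3) ℂ :=
  fundamentalRep_mem_unitaryGroup

/-- **(h3) for the coupling shift at `SU(3)`, `d = 4`**: `‖t • wilson‖_{b,κ} ≤ t · 288 e^{3κ} b⁴`
for `t ≥ 0`, `κ ≥ 0`, `b ≥ 1` (the tree's `|t| · 2N e^{3κ} · 3 d² b^d`). [folklore] -/
theorem normLE_smul_wilson_su3 {Lt : ℕ} [NeZero Lt] {κ : ℝ} (hκ : 0 ≤ κ) {b : ℕ} (hb : 0 < b)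
    {t : ℝ} (ht : 0 ≤ t) :
    (t • QuasiLocalGaugePerturbation.wilson (d := 4) (L := Lt) ρ₃ continuous_ρ₃ b).NormLE κ
      (t * (288 * Real.exp (3 * κ) * (b : ℝ) ^ 4)) := by
  refine (QuasiLocalGaugePerturbation.normLE_smul_wilson ρ₃ continuous_ρ₃ ρ₃_mem_unitary hκ hb t).mono
    (le_of_eq ?_)
  rw [abs_of_nonneg ht]
  push_cast
  ring

/-- **`WilsonConsequences` plus the β-Lipschitz reading of clause (iv)** for the data `(a, L, β')`, the
block scale `ℓ₀`, the decay `κ` and the budget `η`: ONE witness `(φ, c, m, T, Δ)` with the subsequential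
OS limit of the pure `SU(3)` Wilson theory on `⁰𝒮`, non-trivial non-Gaussian curvature, `HasMassGap Δ`,
the uniform lattice gap `HasLatticeMassGap … Δ`, AND: for every `(n, σ, f)` a `k`-uniform `C` with
`|𝔐_k(β'_k) − 𝔐_k(β'_k + t)| ≤ C · t · 288 e^{3κ} ⌊ℓ₀/a_k⌋⁴` for all `0 ≤ t` with
`t · 288 e^{3κ} ⌊ℓ₀/a_k⌋⁴ ≤ η`, eventually in `k`, where `𝔐_k(β)` is the renormalised raw lattice moment
at coupling `β` with the witness's `(c, m)` (the tree's `latticeSchwinger` of the scheme with `β'`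
replaced by `β' + t`). -/
def WilsonBetaLipschitz (κ η : ℝ) (a : ℕ → ℝ) (L : ℕ → ℕ) (ha : ∀ k, 0 < a k)
    (ha₀ : Filter.Tendsto a Filter.atTop (nhds 0))
    (haL : Filter.Tendsto (fun k => a k * L k) Filter.atTop Filter.atTop) (β' : ℕ → ℝ) (ℓ₀ : ℝ) : Prop :=
  let r₃ : LatticeRep SU3 := ⟨3, ρ₃, continuous_fundamentalRep _, fundamentalRep_injective _, fundamentalRep_mem_unitaryGroup⟩;
  ∃ φ : ℕ → ℕ, StrictMono φ ∧ ∃ (c m : YMSpecies SU3 → ℕ → ℝ) (T : OSData (YMSpecies SU3) 4) (Δ : ℝ),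
    0 < Δ ∧
    (∀ n : ℕ, n ≠ 0 → ∀ (σ : Fin n → YMSpecies SU3) (f : Fin n → SchwartzMap (EuclideanSpace ℝ (Fin 4)) ℝ)
      (F : SchwartzMap (Fin n → EuclideanSpace ℝ (Fin 4)) ℂ),
      IsTensorOf F (fun i => ofRealTest (f i)) → IsOffDiagonal F →
        Filter.Tendsto (fun j : ℕ => ((latticeSchwinger ρ₃
          (⟨a, ha, ha₀, β', L, haL, c, m⟩ : SpeciesScheme (YMSpecies SU3)) (fun s => s.F) (φ j) n σ f : ℝ) : ℂ))
          Filter.atTop (nhds (T.schwinger n σ F))) ∧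
    T.IsNontrivial r₃.curvature ∧ T.IsNonGaussian r₃.curvature ∧ T.HasMassGap Δ ∧
    HasLatticeMassGap r₃ (⟨a, ha, ha₀, β', L, haL, c, m⟩ : SpeciesScheme (YMSpecies SU3)) Δ ∧
    ∀ (n : ℕ) (σ : Fin n → YMSpecies SU3) (f : Fin n → SchwartzMap (EuclideanSpace ℝ (Fin 4)) ℝ),
      ∃ C : ℝ, ∀ᶠ k in Filter.atTop, ∀ t : ℝ, 0 ≤ t →
        t * (288 * Real.exp (3 * κ) * (⌊ℓ₀ / a k⌋₊ : ℝ) ^ 4) ≤ η →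
          |latticeSchwinger ρ₃ (⟨a, ha, ha₀, β', L, haL, c, m⟩ : SpeciesScheme (YMSpecies SU3))
              (fun s => s.F) k n σ f -
            latticeSchwinger ρ₃ (⟨a, ha, ha₀, fun k => β' k + t, L, haL, c, m⟩ : SpeciesScheme (YMSpecies SU3))
              (fun s => s.F) k n σ f| ≤
          C * (t * (288 * Real.exp (3 * κ) * (⌊ℓ₀ / a k⌋₊ : ℝ) ^ 4))

/-- **The crux read on the pure Wilson theory in the β-direction.** If `RobustYangMills` holds with
constants `(η₀, κ)`, then for all scaling data, every `N_f = 0` two-loop a.f. coupling sequence `β'` and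
every block scale `ℓ₀ > 0`, `WilsonBetaLipschitz κ (η₀ / max 1 (afBeta 0 Λ' ℓ₀)) a L β' ℓ₀` holds: feed
`W ≡ 0` (admissible: `isReflectionPositive_zero_odd`, `normLE_zero`, (h4) vacuous) and compare in clause
(iv) with the coupling shift `W' = t • wilson ρ₃ ⌊ℓ₀/a_k⌋` — admissible by §2 for
`0 ≤ t ≤ η / (288 e^{3κ} ⌊ℓ₀/a_k⌋⁴)` — whose perturbed Schwinger functions are the Wilson ones at
`β'_k + t` (`expectation_smul_wilson`). [folklore] -/
theorem robustYangMills_imp_betaLipschitz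
    (hR : Summit.QuantumFields.QCD.Theses.NestedDissectionSea.RobustYangMills) :
    ∃ η₀ : ℝ, 0 < η₀ ∧ ∃ κ : ℝ, 0 ≤ κ ∧
      ∀ (a : ℕ → ℝ) (L : ℕ → ℕ) (ha : ∀ k, 0 < a k) (ha₀ : Filter.Tendsto a Filter.atTop (nhds 0))
        (haL : Filter.Tendsto (fun k => a k * L k) Filter.atTop Filter.atTop) (β' : ℕ → ℝ) (Λ' : ℝ),
        0 < Λ' → Filter.Tendsto (fun k => β' k - afBeta 0 Λ' (a k)) Filter.atTop (nhds 0) →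
          ∀ ℓ₀ : ℝ, 0 < ℓ₀ → WilsonBetaLipschitz κ (η₀ / max 1 (afBeta 0 Λ' ℓ₀)) a L ha ha₀ haL β' ℓ₀ := by
  obtain ⟨η₀, hη₀, κ, hκ, h⟩ := hR
  refine ⟨η₀, hη₀, κ, hκ, fun a L ha ha₀ haL β' Λ' hΛ' hβ' ℓ₀ hℓ₀ => ?_⟩
  have h1 := h a L ha ha₀ haL β' Λ' hΛ' hβ' ℓ₀ hℓ₀
  have hη : 0 ≤ η₀ / max 1 (afBeta 0 Λ' ℓ₀) :=
    div_nonneg hη₀.le (le_trans zero_le_one (le_max_left _ _))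
  have hpos : ∀ᶠ k in atTop, 0 ≤ β' k := eventually_nonneg_of_af ha ha₀ hΛ' hβ'
  have hL1 : ∀ᶠ k in atTop, 1 ≤ L k := by
    have h2 : ∀ᶠ k in atTop, (1 : ℝ) ≤ a k * L k := haL.eventually_ge_atTop 1
    have h3 : ∀ᶠ k in atTop, a k ≤ 1 := (ha₀.eventually (gt_mem_nhds one_pos)).mono fun k hk => hk.le
    filter_upwards [h2, h3] with k hk hk'
    by_contra hcon
    push Not at hcon
    have : L k = 0 := by omega
    rw [this] at hk
    simp at hk
    linarith
  have hb1 : ∀ᶠ k in atTop, 0 < ⌊ℓ₀ / a k⌋₊ := by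
    filter_upwards [ha₀.eventually (eventually_le_nhds hℓ₀)] with k hk
    exact Nat.floor_pos.2 ((one_le_div (ha k)).2 hk)
  obtain ⟨φ, hφ, c, m, T, Δ, hΔ, hconv, hnt, hng, hgapT, hgapL, hlip⟩ := h1 (fun k S => 0) (by
    filter_upwards [hpos, hL1] with k hk hkL S hS
    refine ⟨fun v U => by simp, fun U => by simp, fun π U => by simp,
      isReflectionPositive_zero_odd ρ₃ (le_trans hkL hS) continuous_ρ₃ hk _,
      QuasiLocalGaugePerturbation.normLE_zero hη, ?_⟩
    rintro X - ⟨U, hU⟩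
    simp at hU)
  refine ⟨φ, hφ, c, m, T, Δ, hΔ, fun n hn σ f F hF hF' => ?_, hnt, hng, hgapT, fun A B => ?_, fun n σ f => ?_⟩
  · have := hconv n hn σ f F hF hF'
    refine this.congr fun j => ?_
    exact congrArg (fun r : ℝ => (r : ℂ))
      (perturbedLatticeSchwinger_zero ρ₃
        (⟨a, ha, ha₀, β', L, haL, c, m⟩ : SpeciesScheme (YMSpecies SU3))
        (bs := fun k => ⌊ℓ₀ / a k⌋₊) (fun s => s.F) (φ j) n σ f)
  · obtain ⟨C, hC⟩ := hgapL A B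
    refine ⟨C, ?_⟩
    filter_upwards [hC] with k hk S hS n hn
    have := hk S hS n hn
    beta_reduce at this
    rwa [QuasiLocalGaugePerturbation.connectedCorr_zero] at this
  · obtain ⟨C, hC⟩ := hlip n σ f
    refine ⟨C, ?_⟩
    filter_upwards [hC, hpos, hL1, hb1] with k hk hβk hLk hbk t ht htη
    have e1 : perturbedLatticeSchwinger ρ₃ (⟨a, ha, ha₀, β', L, haL, c, m⟩ : SpeciesScheme (YMSpecies SU3))
        (fun k' => (0 : QuasiLocalGaugePerturbation 4 (2 * L k' + 1) SU3 ⌊ℓ₀ / a k'⌋₊)) (fun s => s.F) k n σ f =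
        latticeSchwinger ρ₃ (⟨a, ha, ha₀, β', L, haL, c, m⟩ : SpeciesScheme (YMSpecies SU3)) (fun s => s.F) k n σ f :=
      perturbedLatticeSchwinger_zero ρ₃ _ _ k n σ f
    have e2 : perturbedLatticeSchwinger ρ₃ (⟨a, ha, ha₀, β', L, haL, c, m⟩ : SpeciesScheme (YMSpecies SU3))
        (fun k' => t • QuasiLocalGaugePerturbation.wilson (d := 4) (L := 2 * L k' + 1) ρ₃ continuous_ρ₃ ⌊ℓ₀ / a k'⌋₊)
        (fun s => s.F) k n σ f =
        latticeSchwinger ρ₃ (⟨a, ha, ha₀, fun k => β' k + t, L, haL, c, m⟩ : SpeciesScheme (YMSpecies SU3))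
          (fun s => s.F) k n σ f := by
      simp only [perturbedLatticeSchwinger]
      erw [QuasiLocalGaugePerturbation.expectation_smul_wilson]
      rfl
    have key := hk (fun k' S => t • QuasiLocalGaugePerturbation.wilson ρ₃ continuous_ρ₃ ⌊ℓ₀ / a k'⌋₊)
      (fun S hS => ⟨fun v U => total_smul_wilson_shift ρ₃ continuous_ρ₃ _ t v U,
        fun U => total_smul_wilson_timeReflect ρ₃ continuous_ρ₃ _ t U,
        fun π U => total_smul_wilson_perm ρ₃ continuous_ρ₃ _ t π U,
        isReflectionPositive_smul_wilson ρ₃ continuous_ρ₃ (le_trans hLk hS) _ (by linarith),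
        (normLE_smul_wilson_su3 hκ hbk ht).mono htη,
        fun X _ hne y hy y' hy' i => rangeControl_smul_wilson ρ₃ continuous_ρ₃ hbk t X hne y hy y' hy' i⟩)
      (t * (288 * Real.exp (3 * κ) * (⌊ℓ₀ / a k⌋₊ : ℝ) ^ 4)) (by positivity)
      (fun S hS => by
        have := (QuasiLocalGaugePerturbation.normLE_zero le_rfl).sub
          (normLE_smul_wilson_su3 (Lt := 2 * S + 1) hκ hbk ht (t := t))
        rwa [zero_add] at this)
    beta_reduce at key
    rw [e1, e2] at key
    exact key

end SU3Shift


/-! ### §6d The energy budget of an admissible perturbation: `η` per block, uniformly in the field -/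

section Budget

variable {d L : ℕ} [NeZero L] {G : Type*} [Group G] [MeasurableSpace G] {b : ℕ}

/-- **Energy budget (h3) ⇒ `|W(U) − W_∅| ≤ η · #blocks` for EVERY real configuration `U`**: the
non-constant part of the total of a perturbation with `‖W‖_{b,κ} ≤ η`, `κ ≥ 0`, is bounded by `η`
per block — the quantitative content of item 4 of the header (an (h1a)-invariant local density of
coefficient `λ` evaluated at a translation-invariant `U` then forces `λ ≤ η b⁻⁴ / |t(U)|`). Two-sided
form of the tree's large-field floor bound `HasLargeFieldFloor.act_empty_sub_le_total`. [folklore] -/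
theorem abs_total_sub_act_empty_le {W : QuasiLocalGaugePerturbation d L G b} {κ η : ℝ}
    (h : W.NormLE κ η) (hκ : 0 ≤ κ) (U : GaugeConfig d L G) :
    |W.total U - W.act ∅ U| ≤ η * (blockCorners (d := d) (L := L) b).card := by
  have h₁ := (QuasiLocalGaugePerturbation.HasLargeFieldFloor.of_normLE h).act_empty_sub_le_total hκ U
  have h₂ := (QuasiLocalGaugePerturbation.HasLargeFieldFloor.of_normLE h.neg).act_empty_sub_le_total hκ U
  rw [QuasiLocalGaugePerturbation.total_neg] at h₂
  simp only [QuasiLocalGaugePerturbation.neg_act, Pi.neg_apply] at h₂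
  rw [abs_le]
  constructor <;> linarith

end Budget

end Summit.QuantumFields.QCD.Cruxes.RobustYangMills.Disproof
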